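import Literature.MathematicalPhysics.QuantumFieldTheory.Balaban1983to89.B8Prop3MultiLevelTorusEta
import Literature.MathematicalPhysics.QuantumFieldTheory.Balaban1983to89.B6HolderPairMemberV1
import Literature.MathematicalPhysics.QuantumFieldTheory.Balaban1983to89.B6GradLegKLevelV1
import Literature.MathematicalPhysics.QuantumFieldTheory.Balaban1983to89.B6SectACriticalPointV1
import Literature.MathematicalPhysics.QuantumFieldTheory.Balaban1983to89.B6Prop26HolderGradKLevelV1
import Literature.MathematicalPhysics.QuantumFieldTheory.Balaban1983to89.B8Thm4MultiLevelTorus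
import Literature.MathematicalPhysics.QuantumFieldTheory.Balaban1983to89.B6Ineq2137GradKLevelV1
import Literature.MathematicalPhysics.QuantumFieldTheory.Balaban1983to89.B6HolderNormV1

/-!
# `Balaban1983to89.B8Prop3MultiLevelTorusHolder` — T. Bałaban, *Spaces of regular gauge field configurations on a lattice and gauge fixing
# conditions*, Commun. Math. Phys. **99** (1985) 75–102 [Balaban1985RegularSpaces], **THE HÖLDER MEMBER `‖A‖_{1,β} < B₂(β₀)(α₀ + α₁)(Lʲη)^{−2−β}`
# OF (1.36) p. 82 / (1.62) p. 87** (PROPOSITION 3 p. 87: *"B₂(β₀) = 5dLB₀(β₀) … B₀(β₀) on β₀ also"*) **AT THE FLAT BACKGROUND `U₀ = 1` ON THE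
# `k`-LEVEL V1 TORUS, linear chart, for Theorem 4's `A = A′ − ∂λ` — MODULO THE [B6] (2.137)₁ PAIR MAJORANT OF `∇_νG(1)`** (v1.0/v1.1),
# **HYPOTHESIS-FREE ON THE [B6] SIDE since v1.2** (§§9–13: p22's H3b `B6Ineq2137GradKLevelV1.ineq2137_grad_kLevel` read through p38's padded
# family; §13 the Hölder-quotient form of [B5] (1.109)) (rows B8.Prop3, B8.Eq1.36, B8.Eq1.62, B8.Thm4, B8.Thm2 cells; heads unchanged)

statement-level skeleton of published theorems with citation tags; proofs where landed; nothing here is a claim about the Yang–Mills mass gap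

PDF held: `paper:balaban1985-cmp99-regular-spaces-gauge-fixing` (journal page = PDF page + 74); pp. 82, 86, 87 [PDF 8, 12, 13] re-read AS IMAGES this
session (renders `run/shared/lean/pub/pub-balaban/b2b-balaban-ref1/pages/1985-cmp99-regular-spaces-gauge-fixing/1985-cmp99-regular-spaces-gauge-fixing-
p0NN-x2.png`); [B6] = T. Bałaban, *Propagators and renormalization transformations for lattice gauge theories. II*, Commun. Math. Phys. **96** (1984)
223–250 [Balaban1984PropagatorsII], p. 224 [PDF 2] render re-read (x2), p. 247 through p22's verbatim quotation in `B6Prop26HolderGradKLevelV1` (referee-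
signed, ref-4 Gen 94); [B5] = *… I*, CMP **95** (1984) [Balaban1984PropagatorsI] (1.109) p. 35 through the same quotation.

CITATION HEADER (lean-in-tree rule).  Cell `lit-balaban` (HOME `run/shared/lean/pub/lit-balaban/`), unit `lit-balaban-r05` gen 72 (B8 reader/typer and
fold owner; free target under protocol G.5-34(d), TAKING HOME/STATUS.md 2026-08-25T01:41:30Z, cc p22 / p38 / r03).  WHAT IS REPRODUCED = SKELETON
rows **B8.Prop3** / **B8.Eq1.62** / **B8.Eq1.36** (+ cells B8.Thm4 / B8.Thm2): the THIRD member of (1.36)/(1.62) — the Hölder norm of the gradient —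
as «kernel-checked proof of a model instance, modulo one displayed [B6]-side input», on the carriers of this seat's multi-level flat programme
(`B8Prop3MultiLevelTorus*`, `B8Thm4MultiLevelTorus`): p21's `k`-level nested torus family `D : TDomains d ℓ M_h k P′ R` read through r03's V1 chart
(`PV`, `domT`, `blkV1`), the genuine `G(1) = Δ_a⁻¹` of [B6] (2.19)/(2.22) (`B6SectAVectorModelV1.GE`), p38's componentwise forward difference
`∇_ν = DV ν c′` ([B5] (1.4) at `U₀ = 1`), p22's pair-difference operator `P_{x,x′}` (`B6HolderPairMemberV1.pairOp`, [B5] (1.109) at one pair).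
The four sup members of (1.36)/(1.39)/(1.62) at `U₀ = 1` are in the tree HYPOTHESIS-FREE (`B8Prop3MultiLevelTorusP26.prop3_multiLevelTorus_V1_P26_vector`
v1.5 p368650, `B8Thm4MultiLevelTorus.thm4_multiLevelTorus_V1` p383020, both ref-4 SIGNED); the Hölder member was their declared HONEST-SCOPE gap
(«(ii) NOT part of the instance: the Hölder member … the `k`-level Hölder inputs are p38's/p22's lane»).  THIS MODULE closes the B8 side of that gap:
the Hölder member follows from (1.58) line 2 and the [B6] (2.137)₁ PAIR MAJORANT of `∇_νG(1)` by the cell's Lemma-2.1 summation engine, and the pair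
majorant is DISPLAYED as the hypothesis, LITERALLY in the conclusion shape of p22's `B6Prop26HolderGradKLevelV1.prop26_2137_grad_kLevel_of_legs`
(p374136 ✓ 3844cfcc0e14: `HasMajorant (P_{x,x′}·∇_ν·onFun G) ((A·C_H)·Pw(y)·e^{−δ₃d_T})` with the intended weight `Pw(y) = t^α·(L^{j(y)}·|c′|⁻¹)`), whose
per-cube Hölder first legs are p22/p38's lane in progress (H3b `B6Ineq2137GradKLevelV1` announced, HOME/STATUS 2026-08-24T13:40Z) — the socket pattern of
this lineage (gens 61–69: slots fed verbatim when the producer lands; nothing of the producer restated).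

WHAT IS PRINTED (verbatim).  p. 82 [PDF 8], (1.36): *"U₁ = e^{iηA}, |A| < B₁(α₀ + α₁)(Lʲη)⁻¹, |∇^η_{U₀}A| < B₁(α₀ + α₁)(Lʲη)⁻², ‖A‖_{1,β} <
B₂(β₀)(α₀ + α₁)(Lʲη)^{−2−β}, β ≦ β₀ < 1, on Ω_j, j = 0, 1, …, k"*.  p. 86 [PDF 12]: *"They imply finally A = G(U₀)J − G(U₀)D^{η*}_{U₀}D_{U₀}H(U₀)B₁ +
H(U₀)B₁ = G(U₀)J + G(U₀)Σ_jQ*_jΛ_j(Lʲη)⁻³B₁, (1.58) where the operator G(U₀) was introduced and investigated in [4]."* … *"Theorem 3.3 of [4] implies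
the bounds: |A|₍₋₁₎, |∇^η_{U₀}A|₍₋₂₎, |D^{η*}_{U₀}D^η_{U₀}A|₍₋₃₎, |Δ^η_{U₀}A|₍₋₃₎ ≦ B₀(|J|₍₋₃₎ + |B₁|) ≦ B₀(2α₀ + 36dα₂|∇^η_{U₀}A|₍₋₂₎ + 50dα₂³ + 10dα₀α₂ +
2dLα₁ + C₂α₂²). (1.59)"*; *"where the norms |·|₍α₎ were introduced in [4]. For the reader's convenience let us recall the definition: |A|₍α₎ = sup_j
sup_{Ω_j} (Lʲη)^{−α}|A|."*  p. 87 [PDF 13], (1.62): *"|A| < 5dLB₀(α₀ +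
α₁)(Lʲη)⁻¹, |∇^η_{U₀}A| < 5dLB₀(α₀ + α₁)(Lʲη)⁻², ‖A‖_{1,β} < 5dLB₀(β)(α₀ + α₁)(Lʲη)^{−2−β}, |D^{η*}_{U₀}D^η_{U₀}A|, |Δ^η_{U₀}A| < 5dLB₀(α₀ + α₁)(Lʲη)⁻³
on Ω_j. (1.62)"*; *"**Proposition 3.** If U₀, U₁U₀ satisfy (1.40)–(1.42) with α₀, α₁, α₂ bounded by a constant depending on d and L only, and α₂
satisfies the additional restriction (1.61), then U₁ satisfies (1.36)–(1.39) with B₁ = 5dLB₀, B₂(β₀) = 5dLB₀(β₀), where B₀, B₀(β₀) are the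
corresponding norms of the operators G(U₀), H(U₀), and depend on d and L only, B₀(β₀) on β₀ also."*  [B6] p. 247 (through `B6Prop26HolderGradKLevelV1`):
*"‖ζ∇GJ‖_α, ‖ζG∇*J‖_α ≤ O(1)(Lʲη)^{1−α}(‖ζ‖^ξ_α + |ζ|)e^{−δ₃d(y,y′)}|J|, ξ = L^{−j} (2.137) for 0 ≤ α < 1 … with the constant O(1) depending on d, L and
α (O(1) → ∞ if α → 1)"*; [B5] (1.109) p. 35: *"‖A‖_α = max_μ sup_{x,x′: |x−x′| ≤ 1} |x − x′|^{−α}|A_μ(x) − A_μ(x′)|"*.  [B6] p. 224 [PDF 2]: *"λ = 0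
on Λ₀, Q′_jλ = 0 on Λ_j, j = 1, …, k. (2.7)"*, *"Let us notice that we admit the case when some domains Ω_j are equal to T_η"*.

THE INSTANCE (dictionary print ↦ Lean; the torus typing of the lineage, as in `B8Thm4MultiLevelTorus` — nothing new).  `U₀ = 1` on the `k`-LEVEL V1
TORUS `Site (PV d ℓ m K hd hL) 0`, nested family `D : TDomains d ℓ M_h k P′ R` read as `domT hN D hk` (levels `1 … k`, `Ω₁ = T_η`), factor `c′ ≠ 0`,
`η = |c′|⁻¹`, weights `w` in r03's `GlobalBand b₀ b₁ c′ w`; linear chart: the perturbation IS the real bond field `A′`, a gauge transformation IS the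
site field `λ`, the action IS `A′ ↦ A′ − ∂λ` (`∂ = dE c′`), the restriction (1.29) IS `λ ∈ ker Q′` (`QpE`), (1.38)/(1.42) IS `R∂*A = 0` (`RE`, `dsE`),
`D*D` at `U₀ = 1` IS `dcsE c′ ∘ dcE c′`, `Q_j` IS `QE`, `∇^η_{U₀}` at `U₀ = 1` IS p38's `DV ν c′ = c′·(S_ν − 1)` componentwise; (1.58) line 2 at `U₀ = 1`
IS `A = G(1)(J + Q*aB)` (`B8Ineq159MultiLevelTorus.eq158_line2_V1`).  THE HÖLDER MEMBER, read at ONE PAIR of fine bonds `(x, x′)` (print: same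
component, `|x − x′| ≤ ξ = Lʲη` on the scale of `Ω_j`; [B5] (1.109) = the sup over such pairs of `|x − x′|^{−β}|(∇_νA)(x) − (∇_νA)(x′)|`): the numerator
`(∇_νA)(x) − (∇_νA)(x′)` is the value at `x` of p22's `P_{x,x′}·∇_ν` applied to `A` (`pairOp_mul_apply`), so that — exactly as the sup member `|∇A|₍₋₂₎`
follows from the (2.136)₂ majorant of `∇_ν∘G(1)` — the Hölder numerator follows from a majorant of `P_{x,x′}·∇_ν·onFun G(1)`; [B6]'s (2.137)₁ supplies
`O(1)·(Lʲη)·t^β·e^{−δ₃d_T(y,y′)}` with `t = |x − x′|/(L^{j(y(x))}η) ≤ 1` (p22's UNITS paragraph), i.e. the prefactor `C_P·(L^{j(y)}η)` with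
`C_P = O(1)·t^β` — the shape `C·((Lʲ)η)^1·e^{−σd_T}` of this lineage's engine `B8Prop3MultiLevelTorusEta.sup347_eta` with `p = 1`.  Summing the source
`X = J + Q*aB`, `|X|₍₋₃₎ ≦ (1 + 2a₁)(|J|₍₋₃₎ + |B₁|)` (`abs_QsE_aE_le_eta`), over its blocks with the Lemma-2.1 budget (`n = 3`) gives
`|(∇_νA)(x) − (∇_νA)(x′)| ≦ B₀·C_P·(1 + 2a₁)(|J|₍₋₃₎ + |B₁|)·((L^{j(x)})η)⁻²`, and dividing by `|x − x′|^β = (t·L^{j(x)}η)^β` (§5) print's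
`‖A‖_{1,β} < B₀(β)(…)(Lʲη)^{−2−β}` with `B₀(β) = B₀·O(1)` («B₀(β₀) on β₀ also»: [B6]'s `O(1) → ∞ if α → 1`).

WHAT THIS MODULE PROVES (kernel-checked, 0 sorry, no `… : Prop` fact, theorems only; imports `B8Prop3MultiLevelTorusEta` (own, g62) + `B6HolderPairMemberV1`
(p22 g26, `pairOp`) + `B6GradLegKLevelV1` (p38 g30, `DV`) + `B6SectACriticalPointV1` (p21 g5) [+ v1.1: `B6Prop26HolderGradKLevelV1` (p22 g26, H2), own `B8Thm4MultiLevelTorus`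
(g71); + v1.2: `B6Ineq2137GradKLevelV1` (p22 g28/g30, H3b, p391980), `B6HolderNormV1` (p27 g90, the census vocabulary `AdmV1`/`tparV1`)] — all BY
NAME, nothing re-declared).
§1 `pairOp_mul_apply_self` — `(P_{x,x′}·T)u(x) = (Tu)(x) − (Tu)(x′)` (one line over p22's `pairOp_mul_apply`).
§2 **`ineq159_holder_member_eta`** — THE OPERATOR STEP, spacing `η` explicit, ANY left factor `T` (standing for `∇_ν`; also `1`, giving the Lipschitz-
   in-the-output member of `A` itself): for every `σ > 0` there are `B₀ ≥ 1`, `N₁ ≥ 1` (functions of `d, ℓ, σ` — «depend on d and L only») such that on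
   every admissible torus datum, for every `c′ ≠ 0`, `w > 0`, `η > 0`, window `|w_{(j,c)}| ≦ a₁(Lʲ)^{d+1}((Lʲ)η)⁻²`, pair `(x, x′)`, `C_P ≥ 0`: IF
   `HasMajorant (P_{x,x′}·T·onFun G(1)) (C_P·((Lʲ)η)·e^{−σd_T})` on `blkV1 hN D`, THEN every `A` with (1.55) `∂*∂A = J`, (1.42) `R∂*A = 0`, (1.56)
   `QA = B`, `|J(b)| ≦ n_J((L^{j(b)})η)⁻³`, `|B_{(j,c)}| ≦ β((Lʲ)η)⁻¹` obeys `|(TA)(x) − (TA)(x′)| ≦ B₀C_P(1 + 2a₁)(n_J + β)((L^{j(x)})η)⁻²`.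
§3 **`ineq159_holder_member_pref`** — THE ROUTE V SOCKET: §2 with `T := ∇_ν = DV ν c′`, `η := |c′|⁻¹`, the window = `GlobalBand b₀ b₁ c′ w`, the
   hypothesis LITERALLY `HasMajorant (geomT D) (blkV1 hN D) (pairOp x x′ * DV ν c′ * onFun (GE (domT hN D hk) hc′ hw)) (fun y y′ ↦ C_P·((geomT D).len y·
   |c′|⁻¹)·e^{−σ d_T(y,y′)})` — p22's conclusion shape with `A·C_H·Pw(y) ↦ C_P·(L^{j(y)}|c′|⁻¹)`.
§4 **`thm4_holder_member_V1`** — THE HÖLDER MEMBER OF (1.36)/(1.62) IN THEOREM 4's SETTING AT `U₀ = 1` (the construction's data as in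
   `B8Thm4MultiLevelTorus`: perturbation `A′` with the processed (1.34)/(1.66) sizes `|(∂*∂A′)(b)| ≦ 2α₀(L^{j(b)}η)⁻³`, `|(Q_jA′)(c)| ≦ 2dLα₁(Lʲη)⁻¹`; ANY
   restricted `λ ∈ N(Q′)` in the Landau gauge `R∂*(A′ − ∂λ) = 0`; `A := A′ − ∂λ`): under the §3 pair majorant for `(x, x′, ν)`,
   `|(∇_νA)(x) − (∇_νA)(x′)| ≦ 2dL·B₀·C_P·(1 + 2b₁)(α₀ + α₁)·((L^{j(x)})η)⁻²` — print's «5dLB₀(β)(α₀ + α₁)(Lʲη)^{−2−β}» before the division of §5.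
§5 **`holderQuotient_of_pairBound`** — THE HÖLDER-QUOTIENT READING ([B5] (1.109)): if `C_P = K·t^β` with `t > 0` the relative distance of the pair at the
   scale of the output block and `m = (L^{j(x)})η`, a pair bound `Δ ≦ B·(K·t^β)·S·m⁻²` is `Δ·((t·m)^β)⁻¹ ≦ B·K·S·m⁻²·m^{−β}` — `|x − x′|^{−β}·Δ ≦
   …(Lʲη)^{−2−β}` with `|x − x′| = t·m`.
§6 (v1.1) **`thm4_holder_member_V1_of_legs`** — §4 with its pair-majorant hypothesis DISCHARGED by p22's H2 `prop26_2137_grad_kLevel_of_legs` fed VERBATIM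
   (Hölder weight `Pw(y) = τ·(L^{j(y)}·|c′|⁻¹)`, rate `δ₃ = delta3 β (2σ)`, `β < 1`): the Hölder member of (1.36)/(1.62) for Theorem 4's `A` at `U₀ = 1`
   MODULO THE PER-CUBE HÖLDER FIRST LEGS ONLY (p22's displayed hypothesis, the tree's remaining [B6]-side input of the `k`-level (2.137)₁), constant
   `2dL·B₀·(A·C_H·τ)·(1 + 2b₁)`, on H2's admissible tori (`k ≥ 2`, cubes placed, `M₂ ≤ L·M_h`) with this file's threshold `N₁ + 1 ≤ R·L·M_h`.
§7 (v1.1) **`thm2_multiLevelTorus_V1_five`** — THEOREM 2 AT `U₀ = 1` ON THE `k`-LEVEL V1 TORUS WITH THE COMPLETE CONCLUSION LIST (1.36)–(1.39): own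
   `B8Thm4MultiLevelTorus.thm4_multiLevelTorus_V1` (∃! restricted Landau `λ`, (1.37), the four sup members, `B₁ = 5dL·B₀′`) AND §4's Hölder member in ONE
   sentence, the latter MODULO the (2.137)₁ pair majorant at a rate `σ_H` (the `k`-level twin of gen 46's `B8Eq136HolderFlatTorus.thm2_flat_five`).
§8 (v1.1) **`prop3_holder_member_V1_P26`** — PROPOSITION 3's Hölder member IN PROPOSITION 3's OWN SETTING (the (1.55)/(1.56) size lines with `α₂`, `C₂`,
   «B₀′36dα₂ ≦ ½», `50dα₂ ≤ 1`, (1.61) — the binders of own `prop3_multiLevelTorus_V1_P26_vector`), modulo the pair majorant: the `|∇A|₍₋₂₎`-term of (1.55) is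
   bootstrapped through `_vector`'s hypothesis-free sup member and the printed arithmetic (1.59) ⟹ (1.60) ⟹ (1.62) gives `|J|₍₋₃₎ + |B₁| ≦ 5d_PL_P(α₀ + α₁)`,
   hence `|(∇_νA)(x) − (∇_νA)(x′)| ≦ 5d_PL_P·B_H·C_P·(1 + 2b₁)·(α₀ + α₁)·((L^{j(x)})η)⁻²` — print's constant shape «B₂(β₀) = 5dLB₀(β₀)» on the nose.
§9 (v1.2) **`ineq2137_pairMajorant_pad_V1`** — the [B6] (2.137)₁ PAIR MAJORANT of `P_{x,x′}·∇_ν·onFun G(D)` WITH NO DISPLAYED INPUT for every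
   odd `L ≥ 5`, `k ≥ 1`, `P′ ≥ 5L` (one threshold `M₂ ≤ L·M_h`, no `Placed`): p22's H3b `B6Ineq2137GradKLevelV1.ineq2137_grad_kLevel` (p391980;
   `k ≥ 2`, every cube placed) applied to p38's padded family `padT D` (`B6PadLevelV1`; `hLP_of_V1`/`hP5_of_V1`/`hk'_of_V1` of
   `B6Prop26KLevelAssemblyPadV1`) and transported back by `SameOm.GE_eq` / `eT_blkV1` / `dist_eT` / `hasMajorant_of_pad` — a transport, not a new
   estimate (p22's letters: `β` walk exponent, `α` Hölder exponent, `t = |x − x′|_∞/L^{j(y(x))}` for ADMISSIBLE pairs `|x − x′|_∞ ≤ L^{j(y(x))}`,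
   `≤ L^{j(y(x′))}`, same direction).
§10 (v1.2) **`thm4_holder_member_V1_free`** — §4 with the pair majorant DISCHARGED by §9: THE HÖLDER MEMBER OF (1.36)/(1.62) FOR THEOREM 4's `A` AT
   `U₀ = 1` ON THE `k`-LEVEL V1 TORUS WITH NO [B6]-SIDE HYPOTHESIS — `|(∇_νA)(x) − (∇_νA)(x′)| ≦ B₂·t^β·(α₀ + α₁)·((L^{j(y(x))})η)⁻²` for every
   admissible pair, `B₂ = 2dL·B₀·A·(1 + 2b₁)` («B₂(β₀) on β₀ also»), ONE threshold; binders = `thm4_multiLevelTorus_V1`'s (every odd `L ≥ 5`,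
   `k ≥ 1`, `P′ ≥ 5L`).
§11 (v1.2) **`thm2_multiLevelTorus_V1_five_free`** — THEOREM 2 AT `U₀ = 1` ON THE `k`-LEVEL V1 TORUS WITH THE COMPLETE LIST (1.36)–(1.39) AND NO
   [B6]-SIDE HYPOTHESIS: §7 with its pair-majorant clause replaced by §10's hypothesis-free Hölder member (∃! restricted Landau `λ`; (1.37); the
   four sup members with `B₁`; the Hölder member with `B₂·t^β` for every admissible pair); ONE threshold `M₄ ≤ L·M_h`; no «α₀ + α₁ ≦ c₁».
§12 (v1.2) **`prop3_holder_member_V1_P26_free`** — §8 with the pair majorant DISCHARGED by §9: Proposition 3's Hölder member in Proposition 3's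
   own setting, `≦ 5d_PL_P·B₀(β)·t^β·(α₀ + α₁)·((L^{j(y(x))})η)⁻²` with `B₀(β) = B_H·A_H·(1 + 2b₁)` — print's «B₂(β₀) = 5dLB₀(β₀)»; ONE threshold.
§13 (v1.2) **`thm4_holder_quotient_V1_free`** — §10 written as print writes it: for every ADMISSIBLE pair in r03/p27's census vocabulary
   (`B6HolderNormV1.AdmV1 hN D x x′`, `tparV1 hN D x x′ = t`) the HÖLDER QUOTIENT of [B5] (1.109) `t^{−β}·|(∇_νA)(x) − (∇_νA)(x′)| ≦ B₂·(α₀ + α₁)·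
   ((L^{j(y(x))})η)⁻²` — print's `|x − x′|^{−β}|…| ≦ B₂(α₀ + α₁)(Lʲη)^{−2−β}` with `|x − x′| = t·Lʲη` (no new definition; `t = 0` trivial).

HONEST SCOPE / NOT CLAIMED.  (i) `U₀ = 1`, LINEAR chart, `k`-level V1 torus ONLY, as the whole lineage; in addition the lineage's carriers (p21's
`TDomains`, r03's `domT`) have `Ω₁ = T_η`, i.e. print's families (1.3) with `Ω₀ = Ω₁ = T_η` (`Λ₀ = ∅`: no level-0 territory where (1.29) reads
«u = 1», [B6] (2.7) «λ = 0 on Λ₀») — admitted by print («we admit the case where some domains Ω_j are equal to T_η, for example Ω_j = T_η for j = 0,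
1, …, l», p. 77) but a SUB-CASE: in particular the Sect.-F family (1.131) `(T, □₁, …, □_k)` of Proposition 6 (`Λ′₀ = T ∖ □₁ ≠ ∅`) is NOT of this
kind (recorded in the seat's NOTES/HANDOFF as the reason the Prop.-6 corollary of `thm4_multiLevelTorus_V1` is not filed).  (ii) CONDITIONAL on the
displayed [B6]-side input — the (2.137)₁-shape PAIR MAJORANT of `P_{x,x′}·∇_ν·G(1)` for the pair at hand (§3 hypothesis) —, exactly as slots 1/2 of
`B8Prop3MultiLevelTorusLap.prop3_multiLevelTorus_V1_pref_vecLap` were displayed before p38's `prop26_2136_grad_kLevel_unconditional_pad_V1` landed; its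
producer is p22's `prop26_2137_grad_kLevel_of_legs` (modulo the per-cube Hölder first legs, p22/p38 in progress) — v1.0 did not import it (olean then
unbuilt); v1.1 §6 DOES and leaves displayed exactly p22's per-cube first legs (for the weight `Pw(y) = τ·(L^{j(y)}·|c′|⁻¹)`), nothing else on the
[B6] side; **v1.2 (§§9–13): NOTHING on the [B6] side is displayed any more** — p22 g30's H3b `B6Ineq2137GradKLevelV1` (the per-cube Hölder first
legs PROVED, `holderLegs_kLevel`; (2.137)₁ at `k` levels hypothesis-free, `ineq2137_grad_kLevel`, p391980) is imported BY NAME and read on the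
original data through p38's padded family (§9); what remains are the V1-torus data, ONE size threshold, `c′ ≠ 0`, the weight band, the B8-side
hypotheses of the respective setting (Theorem 4's processed sizes + restricted Landau `λ`, resp. Proposition 3's (1.55)/(1.42)/(1.56) + size
lines), and the ADMISSIBILITY of the pair (same direction, `|x − x′|_∞ ≤ L^{j(y(x))}`, `|x − x′|_∞ ≤ L^{j(y(x′))}` — print's `x, x′ ∈ Δ̃(y)`; p22's
HONEST SCOPE (1): the one-sided condition alone does not localise `x′`).  (iii) ONE PAIR AT A TIME, pointwise: print's `‖·‖_{1,β}` on `Ω_j` is the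
sup of §5's quotients over the admissible pairs (same component, `|x − x′| ≤ Lʲη`, [B5] (1.109) at the scale `ξ`); the admissibility of the pair enters
only through the hypothesis (whoever proves the pair majorant proves it for admissible pairs) — no Hölder NORM is defined here (no new definition).
[v1.2: the admissibility is now an explicit hypothesis of §§9–13 (p22's binders; in §13 p27's `AdmV1`), and §13 states the quotient form of (1.109)
pair by pair; p27's `holderV1` — the sup of these quotients at ONE scale — is not asserted a value here, the printed weight `(Lʲη)^{−2−β}` being
level-dependent.]
(iv) Constants: `B₂(β) ↔ 2dL·B₀·(1 + 2b₁)·O(1)` with `B₀ = B₀(d, ℓ, σ)` of `sup347_eta` (`n = 3`) and [B6]'s `O(1) = O(1)(d, L, β)`; the rate `σ` is the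
[B6]-internal `δ₃`; print: «depend on d and L only, B₀(β₀) on β₀ also»; ONE size threshold `N₁ + 1 ≤ R·L·M_h`; «≦» for print's «<».  (v) Real scalar
fibre (abelian model).  (vi) Rows B8.Prop3 / B8.Eq1.36 / B8.Eq1.62 / B8.Thm4 / B8.Thm2 heads do NOT move (cells only).  Value = the last member of
(1.36)/(1.62) wired to its [B6] input on print's multi-level carrier, NOT summit progress; nothing here bears on the Yang–Mills mass gap.

RELATED IN THE TREE, NOT DUPLICATED (stem check 2026-08-25T01:40Z: `ls Balaban1983to89 | grep -i 'B8.*Holder'` = `B8Prop3Holder` (p40 g8: the Hölder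
member of Prop. 3 on the ℤᵈ carriers modulo (1.59), abstract `H(U₀)`), `B8Eq136HolderFlatTorus` (the one-scale flat torus); none on the `k`-level torus).
USED BY NAME: `B8Prop3MultiLevelTorusEta.{sup347_eta, abs_QsE_aE_le_eta, window_of_globalBand}` (own g62), `B8Ineq159MultiLevelTorus.eq158_line2_V1` (own
g61), `B8Ineq192MultiLevelTorus.lenT_pos` (own g54), `B6HolderPairMemberV1.{pairOp, pairOp_mul_apply}` (p22 g26), `B6GradLegKLevelV1.DV` (p38 g30),
`B6SectACriticalPointV1.{QE_dE_eq_zero, curlCurl_comp_dE}` (p21 g5), `B6SectAOperatorsV1.*`, `B6SectAVectorModelV1.GE`, `B6GlobalChartV1.{PV, domT, blkV1}`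
(r03), `B6MultiLevelTorusOperator.TDomains` (p21), `B6CubeWindowV1.GlobalBand` (r03), `B6RandomWalk.HasMajorant` (p21); v1.1: `B6Prop26HolderGradKLevelV1.
prop26_2137_grad_kLevel_of_legs` (p22 g26, p374136 ✓ 3844cfcc0e14), `B6CubeWindowV1.{Placed, Gl, band_le, one_le_of_eight_le, four_le_of_five_le}` (r03),
`B6Prop26KLevelSkeletonV1.hB`, `B6Prop26KLevelSkeletonV2.SbigT`, `B6Prop26Gluing.{mulOp, ind}`, `B6Cover236MultiLevelBlocks.cubes`, `B6RandomWalk.{delta3,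
delta3_pos}`, own `B8Thm4MultiLevelTorus.thm4_multiLevelTorus_V1` (p383020 ✓ 62e887960b4c), own `B8Prop3MultiLevelTorusP26.prop3_multiLevelTorus_V1_P26_vector`
(v1.5 p368650 ✓), `B8ScaledSupNorm.msup`, `LatticeFieldCalculus.laplace` — BY NAME.  v1.1 = APPEND-ONLY (§§6–8 + two imports + these header lines; §§1–5
byte-identical).  v1.2: `B6Ineq2137GradKLevelV1.ineq2137_grad_kLevel` (p22 g28/g30, H3b, p391980), `B6PadLevelV1.{padT, hN_pad, placed_pad,
sameOm_domT_pad, SameOm.GE_eq, eT, eT_blkV1, eT_val, dist_eT, hasMajorant_of_pad, globalBand_pad}` (p38 g29), `B6Prop26KLevelAssemblyPadV1.{hLP_of_V1,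
hP5_of_V1, hk'_of_V1}` (p38 g29), `LatticeFieldCalculus.supDist`, `B6HolderNormV1.{AdmV1, tparV1, tparV1_nonneg}` (p27 g90) — BY NAME.  v1.2 =
APPEND-ONLY (§§9–13 + two imports + these header lines + ONE sentence appended to §7's docstring (ref-4 D-g107-1, zero weight: the no-threshold
declaration repeated); §§1–8 otherwise byte-identical).
-/

namespace Literature.MathematicalPhysics.QuantumFieldTheory.Balaban1983to89.B8Prop3MultiLevelTorusHolder

open B6MultiLevelBoxOperator (N0)
open B6MultiLevelTorusOperator (TDomains)
open B6Geom246MultiLevelTorus (geomT)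
open B6RandomWalk (HasMajorant BlockSupp hasMajorant_mono)
open B8Ineq192MultiLevelTorus (lenT_pos)
open B8Ineq159MultiLevelTorus (eq158_line2_V1)
open B8Prop3MultiLevelTorusEta (sup347_eta abs_QsE_aE_le_eta window_of_globalBand)
open B6GlobalChartV1 (PV blkV1 domT)
open B6SectAOperatorsV1 (dE dsE dcE dcsE QE QpE QsE aE RE BondIdx BondIdxSpace ScalarSpace)
open B6SectAVectorModelV1 (GE)
open BalabanImbrieJaffe1984to88.BIJ85AxialPropagator411 (BondSpace)
open B6Ineq2133TwoScaleV1 (onFun onFun_apply)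
open B6CubeWindowV1 (GlobalBand)
open B6GradLegKLevelV1 (DV)
open B6HolderPairMemberV1 (pairOp pairOp_mul_apply)
open B6SectACriticalPointV1 (QE_dE_eq_zero curlCurl_comp_dE)

noncomputable section

variable {d : ℕ}

/-! ## §1  The value of `P_{x,x′}·T` at `x` -/

section Pair

variable {X : Type} [DecidableEq X]

/-- **THE HÖLDER NUMERATOR AS AN OPERATOR VALUE**: `(P_{x,x′}·T)u(x) = (Tu)(x) − (Tu)(x′)` — the numerator of [B5] (1.109)'s quotient
`|x − x′|^{−α}|A_μ(x) − A_μ(x′)|` for `A_μ = Tu` at the pair `(x, x′)`, read off p22's `pairOp_mul_apply`.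
[cite: Balaban1984PropagatorsI, (1.109) p.35; Balaban1984PropagatorsII, (2.137) p.247 (operator reading, p22's `B6HolderPairMemberV1`)] -/
theorem pairOp_mul_apply_self (x x' : X) (T : Module.End ℝ (X → ℝ)) (u : X → ℝ) :
    (pairOp x x' * T) u x = T u x - T u x' := by
  rw [pairOp_mul_apply, if_pos rfl]

end Pair

/-! ## §2  The operator step: the Hölder member of (1.59)/(1.62) from (1.58) line 2 and a pair majorant, spacing `η` explicit -/

section Eta

open Classical in
/-- **(1.58) ⟹ THE HÖLDER MEMBER OF (1.62), OPERATOR STEP, AT `U₀ = 1` ON THE `k`-LEVEL V1 TORUS, SPACING `η` EXPLICIT, MODULO THE PAIR MAJORANT**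
(«Theorem 3.3 of [4] implies the bounds …», p. 86, for the Hölder entry: [B6] (2.137)₁ «‖ζ∇GJ‖_α ≤ O(1)(Lʲη)^{1−α}(…)e^{−δ₃d(y,y′)}|J|» in the pair form of
p22's `B6Prop26HolderGradKLevelV1`): for every `σ > 0` there are `B₀ ≥ 1`, `N₁ ≥ 1` (functions of `d, ℓ, σ`) such that for every `k`, `M_h ≥ 1`,
`R·L·M_h ≥ N₁ + 1`, `P′_μ ≥ 1`, torus family `D`, V1 volume (`m, K`, `hN`, `hk`), factor `c′ ≠ 0`, weights `w > 0`, EVERY `η > 0`, window `|w_{(j,c)}| ≦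
a₁(Lʲ)^{d+1}((Lʲ)η)⁻²` (`a₁ ≥ 0`), EVERY left factor `T` (for `∇^η_{U₀,ν}|_{U₀=1}`), pair of fine bonds `(x, x′)` and constant `C_P ≥ 0`: IF
`P_{x,x′}·T·onFun G(1)` has the majorant `C_P·((Lʲ)η)·e^{−σd_T(y,y′)}` on `blkV1 hN D` ([B6] (2.137)₁ with `C_P = O(1)t^β`), THEN every vector field `A`
with (1.55) `∂*∂A = J`, (1.42) `R∂*A = 0`, (1.56) `QA = B`, `|J(b)| ≦ n_J((L^{j(b)})η)⁻³` («|J|₍₋₃₎ ≦ n_J») and `|B_{(j,c)}| ≦ β((Lʲ)η)⁻¹` («LʲηQ_jA = B₁,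
|B₁| ≦ β») obeys **`|(TA)(x) − (TA)(x′)| ≦ B₀·C_P·(1 + 2a₁)·(n_J + β)·((L^{j(x)})η)⁻²`** — the numerator of «‖A‖_{1,β} < B₀(β)(|J|₍₋₃₎ + |B₁|)
(Lʲη)^{−2−β}» at the pair, `B₀` INDEPENDENT OF `η`.  Proof: `A = G(1)(J + Q*aB)` (`eq158_line2_V1`), `|J + Q*aB|₍₋₃₎ ≦ (1 + 2a₁)(n_J + β)`
(`abs_QsE_aE_le_eta`), and the Lemma-2.1 engine `sup347_eta` (`p = 1`, `n = 3`) applied to `P_{x,x′}·T·onFun G(1)` at the point `x`.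
[cite: Balaban1985RegularSpaces, (1.62) p.87 («‖A‖_{1,β} < 5dLB₀(β)(α₀+α₁)(Lʲη)^{−2−β}»), Prop. 3 p.87 («B₂(β₀) = 5dLB₀(β₀) … B₀(β₀) on β₀ also»), (1.58)–(1.59) p.86, (1.36) p.82; Balaban1984PropagatorsII, Prop. 2.6 (2.137) p.247, Lemma 2.1 (2.60)–(2.61) p.234, (2.19) p.226; Balaban1984PropagatorsI, (1.109) p.35; Balaban1985BackgroundPropagators, Theorem 3.3 p.399] -/
theorem ineq159_holder_member_eta (d ℓ : ℕ) {σ : ℝ} (hσ : 0 < σ) :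
    ∃ B₀ : ℝ, ∃ N₁ : ℕ, 1 ≤ B₀ ∧ 0 < N₁ ∧
      ∀ (k Mh R : ℕ), 1 ≤ Mh → N₁ + 1 ≤ R * ((ℓ + 1) * Mh) →
      ∀ (P' : Fin (d + 1) → ℕ) (_hP : ∀ μ, 1 ≤ P' μ) (D : TDomains d ℓ Mh k P' R)
        (m K : ℕ) (hd : 1 ≤ d + 1) (hL : Odd (ℓ + 1) ∧ 1 < ℓ + 1)
        (hN : ∀ μ, N0 ℓ Mh k P' μ = (PV d ℓ m K hd hL).sitesPerDir 0) (hk : k ≤ m + K)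
        (cf : ℝ) (hcf : cf ≠ 0) (w : BondIdx (domT hN D hk) → ℝ) (hw : ∀ i, 0 < w i) (η : ℝ), 0 < η →
        ∀ (a₁ : ℝ), 0 ≤ a₁ →
        (∀ i, |w i| ≤ a₁ * (((ℓ : ℝ) + 1) ^ (d + 1)) ^ (i.1.1 : ℕ) * ((((ℓ : ℝ) + 1) ^ (i.1.1 : ℕ) * η) ^ 2)⁻¹) →
        ∀ (T : Module.End ℝ (PBond (PV d ℓ m K hd hL) 0 → ℝ)) (x x' : PBond (PV d ℓ m K hd hL) 0) (CP : ℝ), 0 ≤ CP →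
        HasMajorant (g := geomT D) (blkV1 hN D) (pairOp x x' * T * onFun (GE (domT hN D hk) hcf hw))
          (fun y y' => CP * ((geomT D).len y * η) * Real.exp (-(σ * (geomT D).dist y y'))) →
        ∀ (A J : BondSpace (PV d ℓ m K hd hL)) (B : BondIdxSpace (domT hN D hk)),
          dcsE cf (dcE cf A) = J → RE (domT hN D hk) cf (dsE cf A) = 0 → QE (domT hN D hk) A = B →
          ∀ (nJ β : ℝ), 0 ≤ nJ → 0 ≤ β →
            (∀ b, |J b| ≤ nJ * (((geomT D).len (blkV1 hN D b) * η) ^ 3)⁻¹) →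
            (∀ i, |B i| ≤ β * (((ℓ : ℝ) + 1) ^ (i.1.1 : ℕ) * η)⁻¹) →
            |T (WithLp.ofLp A) x - T (WithLp.ofLp A) x'| ≤
              B₀ * CP * (1 + 2 * a₁) * (nJ + β) * (((geomT D).len (blkV1 hN D x) * η) ^ 2)⁻¹ := by
  obtain ⟨B₀, N₁, hB₀, hN₁, h⟩ := sup347_eta d ℓ hσ 3
  refine ⟨B₀, N₁, hB₀, hN₁, ?_⟩
  intro k Mh R hMh1 hRM1 P' hP D m K hd hL hN hk cf hcf w hw η hη a₁ ha₁ hwin T x x' CP hCP hPair A J B h55 h42 h56 nJ β hnJ hβ hJ hB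
  -- (1.58) line 2 for the genuine operator: `A = G(1)(J + Q*aB)`
  have hA := eq158_line2_V1 (domT hN D hk) hcf hw A J B h55 h42 h56
  -- the source `X = J + Q*aB` in the `η`-weighted `(−3)`-norm
  have hS : 0 ≤ (1 + 2 * a₁) * (nJ + β) := by positivity
  have hX : ∀ b' : PBond (PV d ℓ m K hd hL) 0,
      |(J + QsE (domT hN D hk) (aE (domT hN D hk) w B)) b'| ≤
        (1 + 2 * a₁) * (nJ + β) * (((geomT D).len (blkV1 hN D b') * η) ^ 3)⁻¹ := by
    intro b'
    have h2 := abs_QsE_aE_le_eta hN D hk hη ha₁ hβ w B hwin hB b'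
    have hl0 : 0 ≤ (((geomT D).len (blkV1 hN D b') * η) ^ 3)⁻¹ :=
      inv_nonneg.2 (pow_nonneg (mul_nonneg (lenT_pos D _).le hη.le) 3)
    have hadd : (J + QsE (domT hN D hk) (aE (domT hN D hk) w B)) b' =
        J b' + (QsE (domT hN D hk) (aE (domT hN D hk) w B)) b' := rfl
    rw [hadd]
    refine (abs_add_le _ _).trans ?_
    have := hJ b'
    nlinarith [mul_nonneg ha₁ hβ, mul_nonneg hnJ hl0, mul_nonneg hβ hl0, mul_nonneg (mul_nonneg ha₁ hnJ) hl0]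
  -- the majorant with the prefactor exponent `p = 1`
  have hPair' : HasMajorant (g := geomT D) (blkV1 hN D) (pairOp x x' * T * onFun (GE (domT hN D hk) hcf hw))
      (fun y y' => CP * ((geomT D).len y * η) ^ 1 * Real.exp (-(σ * (geomT D).dist y y'))) :=
    hasMajorant_mono (g := geomT D) (blkV1 hN D) hPair fun y y' => le_of_eq (by rw [pow_one])
  -- the Lemma-2.1 engine at the point `x` for the operator `P_{x,x′}·T·onFun G(1)` and the source `X`
  have key := h k Mh R hMh1 hRM1 P' hP D η hη 1 _ (blkV1 hN D) (pairOp x x' * T * onFun (GE (domT hN D hk) hcf hw)) CP hCP hPair'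
    (WithLp.ofLp (J + QsE (domT hN D hk) (aE (domT hN D hk) w B))) _ hS hX x
  -- `onFun G(1) X = A` as bond functions
  have hGX : onFun (GE (domT hN D hk) hcf hw) (WithLp.ofLp (J + QsE (domT hN D hk) (aE (domT hN D hk) w B))) = WithLp.ofLp A := by
    funext z
    rw [onFun_apply, WithLp.toLp_ofLp, ← hA]
  rw [Module.End.mul_apply, pairOp_mul_apply_self, hGX, pow_one] at key
  have hm : 0 < (geomT D).len (blkV1 hN D x) * η := mul_pos (lenT_pos D _) hη
  have hm0 : (geomT D).len (blkV1 hN D x) * η ≠ 0 := hm.ne'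
  refine key.trans (le_of_eq ?_)
  field_simp

end Eta

/-! ## §3  The ROUTE V socket: `T = ∇_ν = DV ν c′`, `η = |c′|⁻¹`, the window = `GlobalBand`, the hypothesis in p22's letters -/

section Socket

open Classical in
/-- **THE HÖLDER MEMBER, ROUTE V SOCKET**: `ineq159_holder_member_eta` with `T := ∇_ν = DV ν c′` (p38's componentwise forward difference, [B5] (1.4) at
`U₀ = 1`), `η := |c′|⁻¹`, the window = print's (2.16) band `GlobalBand b₀ b₁ c′ w` (`0 ≤ b₀`, `0 ≤ b₁`), and the [B6] (2.137)₁ input written LITERALLY in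
the conclusion shape of p22's `B6Prop26HolderGradKLevelV1.prop26_2137_grad_kLevel_of_legs` — `HasMajorant (geomT D) (blkV1 hN D) (pairOp x x′ * DV ν c′ *
onFun (GE (domT hN D hk) hc′ hw)) (fun y y′ ↦ C_P·((geomT D).len y·|c′|⁻¹)·e^{−σ d_T(y,y′)})` (p22's `A·C_H·Pw(y)` with the intended `Pw(y) = t^β·(L^{j(y)}·
|c′|⁻¹)`, so `C_P = A·C_H·t^β`; ANY `C_P ≥ 0`, `σ > 0`): every `A` with (1.55) `∂*∂A = J`, (1.42) `R∂*A = 0`, (1.56) `QA = B`, `|J(b)| ≦ n_J((L^{j(b)})η)⁻³`,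
`|B_{(j,c)}| ≦ β((Lʲ)η)⁻¹` (`η = |c′|⁻¹`) obeys **`|(∇_νA)(x) − (∇_νA)(x′)| ≦ B₀·C_P·(1 + 2b₁)·(n_J + β)·((L^{j(x)})η)⁻²`**, `B₀ = B₀(d, ℓ, σ)`.
[cite: Balaban1985RegularSpaces, (1.62) p.87, Prop. 3 p.87, (1.58)–(1.59) p.86, (1.36) p.82; Balaban1984PropagatorsII, Prop. 2.6 (2.137) p.247, (2.16) p.225, (2.19) p.226, Lemma 2.1 (2.60)–(2.61) p.234; Balaban1984PropagatorsI, (1.109) p.35, (1.4) p.18; Balaban1985BackgroundPropagators, Theorem 3.3 p.399] -/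
theorem ineq159_holder_member_pref (d ℓ : ℕ) {σ : ℝ} (hσ : 0 < σ) :
    ∃ B₀ : ℝ, ∃ N₁ : ℕ, 1 ≤ B₀ ∧ 0 < N₁ ∧
      ∀ (k Mh R : ℕ), 1 ≤ Mh → N₁ + 1 ≤ R * ((ℓ + 1) * Mh) →
      ∀ (P' : Fin (d + 1) → ℕ) (_hP : ∀ μ, 1 ≤ P' μ) (D : TDomains d ℓ Mh k P' R)
        (m K : ℕ) (hd : 1 ≤ d + 1) (hL : Odd (ℓ + 1) ∧ 1 < ℓ + 1)
        (hN : ∀ μ, N0 ℓ Mh k P' μ = (PV d ℓ m K hd hL).sitesPerDir 0) (hk : k ≤ m + K)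
        (cf : ℝ) (hcf : cf ≠ 0) (w : BondIdx (domT hN D hk) → ℝ) (hw : ∀ i, 0 < w i)
        (b₀ b₁ : ℝ), 0 ≤ b₀ → 0 ≤ b₁ → GlobalBand b₀ b₁ cf w →
        ∀ (ν : Fin (d + 1)) (x x' : PBond (PV d ℓ m K hd hL) 0) (CP : ℝ), 0 ≤ CP →
        HasMajorant (g := geomT D) (blkV1 hN D)
          (pairOp x x' * DV (P := PV d ℓ m K hd hL) ν cf * onFun (GE (domT hN D hk) hcf hw))
          (fun y y' => CP * ((geomT D).len y * |cf|⁻¹) * Real.exp (-(σ * (geomT D).dist y y'))) →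
        ∀ (A J : BondSpace (PV d ℓ m K hd hL)) (B : BondIdxSpace (domT hN D hk)),
          dcsE cf (dcE cf A) = J → RE (domT hN D hk) cf (dsE cf A) = 0 → QE (domT hN D hk) A = B →
          ∀ (nJ β : ℝ), 0 ≤ nJ → 0 ≤ β →
            (∀ b, |J b| ≤ nJ * (((geomT D).len (blkV1 hN D b) * |cf|⁻¹) ^ 3)⁻¹) →
            (∀ i, |B i| ≤ β * (((ℓ : ℝ) + 1) ^ (i.1.1 : ℕ) * |cf|⁻¹)⁻¹) →
            |DV (P := PV d ℓ m K hd hL) ν cf (WithLp.ofLp A) x - DV (P := PV d ℓ m K hd hL) ν cf (WithLp.ofLp A) x'| ≤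
              B₀ * CP * (1 + 2 * b₁) * (nJ + β) * (((geomT D).len (blkV1 hN D x) * |cf|⁻¹) ^ 2)⁻¹ := by
  obtain ⟨B₀, N₁, hB₀, hN₁, h⟩ := ineq159_holder_member_eta d ℓ hσ
  refine ⟨B₀, N₁, hB₀, hN₁, ?_⟩
  intro k Mh R hMh1 hRM1 P' hP D m K hd hL hN hk cf hcf w hw b₀ b₁ hb₀ hb₁ hwb ν x x' CP hCP hPair
  have hη : 0 < |cf|⁻¹ := inv_pos.2 (abs_pos.2 hcf)
  exact h k Mh R hMh1 hRM1 P' hP D m K hd hL hN hk cf hcf w hw |cf|⁻¹ hη b₁ hb₁ (window_of_globalBand hN D hk hb₀ hcf hwb)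
    (DV (P := PV d ℓ m K hd hL) ν cf) x x' CP hCP hPair

end Socket

/-! ## §4  The Hölder member of (1.36)/(1.62) in Theorem 4's setting at `U₀ = 1` (the construction's data as in `B8Thm4MultiLevelTorus`) -/

section Thm4

open Classical in
/-- **THE HÖLDER MEMBER OF (1.36)/(1.62) FOR THEOREM 4's `A = A′ − ∂λ` AT `U₀ = 1` ON THE `k`-LEVEL V1 TORUS, MODULO THE PAIR MAJORANT** (Prop. 3 p. 87:
*"then U₁ satisfies (1.36)–(1.39) with B₁ = 5dLB₀, B₂(β₀) = 5dLB₀(β₀)"*; (1.62): *"‖A‖_{1,β} < 5dLB₀(β)(α₀ + α₁)(Lʲη)^{−2−β} … on Ω_j"*): for every `σ > 0`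
there are `B₀ ≥ 1`, `N₁ ≥ 1` (functions of `d, ℓ, σ`) such that on every admissible torus datum (`M_h ≥ 1`, `R·L·M_h ≥ N₁ + 1`, `P′_μ ≥ 1`, `D`, V1
volume, `c′ ≠ 0`, weights `w > 0` in `GlobalBand b₀ b₁ c′ w`), for every `α₀, α₁ ≥ 0` and every perturbation `A′` with the processed (1.34)/(1.66) sizes of
`B8Thm4MultiLevelTorus.thm4_multiLevelTorus_V1` — `|(∂*∂A′)(b)| ≦ 2α₀(L^{j(b)}η)⁻³` [(1.55)'s `J = ∂*∂A = ∂*∂A′` is gauge invariant], `|(Q_jA′)(c)| ≦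
2dLα₁(Lʲη)⁻¹` on `Λ_j` [(1.37) «Q_jA = Q_jA′ … |B| < 2dLα₁»] —, every restricted `λ ∈ N(Q′)` [(1.29)] in the Landau gauge `R∂*(A′ − ∂λ) = 0` [(1.38)],
and every direction `ν`, pair of fine bonds `(x, x′)` and `C_P ≥ 0` carrying the (2.137)₁ pair majorant of `P_{x,x′}·∇_ν·onFun G(1)` (§3 hypothesis):
`A := A′ − ∂λ` satisfies **`|(∇^η_νA)(x) − (∇^η_νA)(x′)| ≦ 2dL·B₀·C_P·(1 + 2b₁)·(α₀ + α₁)·((L^{j(x)})η)⁻²`** (`η = |c′|⁻¹`, `d, L` of print = `d + 1`,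
`ℓ + 1`) — with `C_P = O(1)·t^β` and §5, print's `‖A‖_{1,β} < B₂(β)(α₀ + α₁)(Lʲη)^{−2−β}`, `B₂(β) = 2dL·B₀·(1 + 2b₁)·O(1)`.  No threshold `c₁`, no
[B6]-side hypothesis beyond the displayed pair majorant.
[cite: Balaban1985RegularSpaces, (1.36) p.82, (1.62) + Prop. 3 p.87, Thm 4 p.88, Thm 2 p.83, (1.29) p.81, (1.37)–(1.38) p.82, (1.55)–(1.56), (1.58) p.86; Balaban1984PropagatorsII, Prop. 2.6 (2.137) p.247, (2.7) p.224, (2.12) p.225, (2.16) p.225; Balaban1984PropagatorsI, (1.109) p.35] -/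
theorem thm4_holder_member_V1 (d ℓ : ℕ) {σ : ℝ} (hσ : 0 < σ) :
    ∃ B₀ : ℝ, ∃ N₁ : ℕ, 1 ≤ B₀ ∧ 0 < N₁ ∧
      ∀ (k Mh R : ℕ), 1 ≤ Mh → N₁ + 1 ≤ R * ((ℓ + 1) * Mh) →
      ∀ (P' : Fin (d + 1) → ℕ) (_hP : ∀ μ, 1 ≤ P' μ) (D : TDomains d ℓ Mh k P' R)
        (m K : ℕ) (hd : 1 ≤ d + 1) (hL : Odd (ℓ + 1) ∧ 1 < ℓ + 1)
        (hN : ∀ μ, N0 ℓ Mh k P' μ = (PV d ℓ m K hd hL).sitesPerDir 0) (hk : k ≤ m + K)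
        (cf : ℝ) (hcf : cf ≠ 0) (w : BondIdx (domT hN D hk) → ℝ) (hw : ∀ i, 0 < w i)
        (b₀ b₁ : ℝ), 0 ≤ b₀ → 0 ≤ b₁ → GlobalBand b₀ b₁ cf w →
      ∀ (A' : BondSpace (PV d ℓ m K hd hL)) (α₀ α₁ : ℝ), 0 ≤ α₀ → 0 ≤ α₁ →
        -- (1.34) processed through (1.55) at `U₀ = 1`: `|D*DA′|₍₋₃₎ ≦ 2α₀`
        (∀ b, |dcsE cf (dcE cf A') b| ≤ 2 * α₀ * (((geomT D).len (blkV1 hN D b) * |cf|⁻¹) ^ 3)⁻¹) →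
        -- (1.66)/(1.35) processed through (1.37)/(1.56): `|Q_jA′| ≦ 2dLα₁(Lʲη)⁻¹` on `Λ_j`
        (∀ i, |QE (domT hN D hk) A' i| ≤ 2 * ((d : ℝ) + 1) * ((ℓ : ℝ) + 1) * α₁ * (((ℓ : ℝ) + 1) ^ (i.1.1 : ℕ) * |cf|⁻¹)⁻¹) →
      -- every restricted `λ` (1.29) in the Landau gauge (1.38)
      ∀ n : ScalarSpace (PV d ℓ m K hd hL), n ∈ LinearMap.ker (QpE (domT hN D hk)) →
        RE (domT hN D hk) cf (dsE cf (A' - dE cf n)) = 0 →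
      ∀ (ν : Fin (d + 1)) (x x' : PBond (PV d ℓ m K hd hL) 0) (CP : ℝ), 0 ≤ CP →
        -- the [B6] (2.137)₁ pair majorant of `P_{x,x′}·∇_ν·G(1)` (p22's conclusion shape)
        HasMajorant (g := geomT D) (blkV1 hN D)
          (pairOp x x' * DV (P := PV d ℓ m K hd hL) ν cf * onFun (GE (domT hN D hk) hcf hw))
          (fun y y' => CP * ((geomT D).len y * |cf|⁻¹) * Real.exp (-(σ * (geomT D).dist y y'))) →
        -- the Hölder member of (1.36)/(1.62) at the pair, before the division by `|x − x′|^β` (§5)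
        |DV (P := PV d ℓ m K hd hL) ν cf (WithLp.ofLp (A' - dE cf n)) x -
            DV (P := PV d ℓ m K hd hL) ν cf (WithLp.ofLp (A' - dE cf n)) x'| ≤
          2 * ((d : ℝ) + 1) * ((ℓ : ℝ) + 1) * B₀ * CP * (1 + 2 * b₁) * (α₀ + α₁) *
            (((geomT D).len (blkV1 hN D x) * |cf|⁻¹) ^ 2)⁻¹ := by
  obtain ⟨B₀, N₁, hB₀, hN₁, h⟩ := ineq159_holder_member_pref d ℓ hσ
  refine ⟨B₀, N₁, hB₀, hN₁, ?_⟩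
  intro k Mh R hMh1 hRM1 P' hP D m K hd hL hN hk cf hcf w hw b₀ b₁ hb₀ hb₁ hwb A' α₀ α₁ hα₀ hα₁ hJ hB n hn hLan ν x x' CP hCP hPair
  -- the construction's data: (1.37) `QA = QA′` and (1.55)'s `J = ∂*∂A = ∂*∂A′` for the restricted `λ`
  have h37 : QE (domT hN D hk) (A' - dE cf n) = QE (domT hN D hk) A' := by
    rw [map_sub, QE_dE_eq_zero (domT hN D hk) cf n hn, sub_zero]
  have h55 : dcsE cf (dcE cf (A' - dE cf n)) = dcsE cf (dcE cf A') := by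
    have h0 : dcsE cf (dcE cf (dE cf n)) = 0 := by
      have hc := LinearMap.congr_fun (curlCurl_comp_dE (P := PV d ℓ m K hd hL) cf) n
      simpa only [LinearMap.comp_apply, LinearMap.zero_apply] using hc
    rw [map_sub, map_sub, h0, sub_zero]
  -- print's `d`, `L`: `1 ≤ dL`
  have hdL : (1 : ℝ) ≤ ((d : ℝ) + 1) * ((ℓ : ℝ) + 1) :=
    one_le_mul_of_one_le_of_one_le (le_add_of_nonneg_left (Nat.cast_nonneg d)) (le_add_of_nonneg_left (Nat.cast_nonneg ℓ))
  -- §3 fed with `J := ∂*∂A′` (`n_J = 2α₀`), `B := QA′` (`β = 2dLα₁`)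
  have key := h k Mh R hMh1 hRM1 P' hP D m K hd hL hN hk cf hcf w hw b₀ b₁ hb₀ hb₁ hwb ν x x' CP hCP hPair (A' - dE cf n)
    (dcsE cf (dcE cf A')) (QE (domT hN D hk) A') h55 hLan h37 (2 * α₀) (2 * ((d : ℝ) + 1) * ((ℓ : ℝ) + 1) * α₁) (by positivity)
    (by positivity) hJ hB
  refine key.trans ?_
  -- `B₀C_P(1 + 2b₁)(2α₀ + 2dLα₁) ≦ 2dL·B₀C_P(1 + 2b₁)(α₀ + α₁)`
  have hw2 : (0 : ℝ) ≤ (((geomT D).len (blkV1 hN D x) * |cf|⁻¹) ^ 2)⁻¹ :=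
    inv_nonneg.2 (pow_nonneg (mul_nonneg (lenT_pos D _).le (inv_nonneg.2 (abs_nonneg cf))) 2)
  have hfac : 0 ≤ B₀ * CP * (1 + 2 * b₁) := mul_nonneg (mul_nonneg (by linarith) hCP) (by linarith)
  have hsum : 2 * α₀ + 2 * ((d : ℝ) + 1) * ((ℓ : ℝ) + 1) * α₁ ≤ 2 * ((d : ℝ) + 1) * ((ℓ : ℝ) + 1) * (α₀ + α₁) := by
    nlinarith
  calc B₀ * CP * (1 + 2 * b₁) * (2 * α₀ + 2 * ((d : ℝ) + 1) * ((ℓ : ℝ) + 1) * α₁) * (((geomT D).len (blkV1 hN D x) * |cf|⁻¹) ^ 2)⁻¹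
      ≤ B₀ * CP * (1 + 2 * b₁) * (2 * ((d : ℝ) + 1) * ((ℓ : ℝ) + 1) * (α₀ + α₁)) * (((geomT D).len (blkV1 hN D x) * |cf|⁻¹) ^ 2)⁻¹ :=
        mul_le_mul_of_nonneg_right (mul_le_mul_of_nonneg_left hsum hfac) hw2
    _ = 2 * ((d : ℝ) + 1) * ((ℓ : ℝ) + 1) * B₀ * CP * (1 + 2 * b₁) * (α₀ + α₁) * (((geomT D).len (blkV1 hN D x) * |cf|⁻¹) ^ 2)⁻¹ := by
        ring

end Thm4

/-! ## §5  The Hölder-quotient reading of a pair bound ([B5] (1.109): division by `|x − x′|^β = (t·Lʲη)^β`) -/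

section Quotient

/-- **THE HÖLDER QUOTIENT** ([B5] (1.109) «|x − x′|^{−α}|A_μ(x) − A_μ(x′)|», (1.36) «‖A‖_{1,β} < B₂(β₀)(α₀ + α₁)(Lʲη)^{−2−β}»): a pair bound
`Δ ≦ B·(K·t^β)·S·m⁻²` with the relative distance `t > 0` of the pair at the scale `m = Lʲη > 0` of the output block (the [B6] constant `C_P = K·t^β`,
any real `β`, `K`, `S`, `B`) IS the quotient bound `Δ·((t·m)^β)⁻¹ ≦ B·K·S·(m²)⁻¹·(m^β)⁻¹` — `|x − x′|^{−β}Δ ≦ B·K·S·(Lʲη)^{−2−β}` with `|x − x′| = t·m`.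
Pure arithmetic (`(t·m)^β = t^β·m^β`).
[cite: Balaban1984PropagatorsI, (1.109) p.35; Balaban1985RegularSpaces, (1.36) p.82, (1.62) p.87] -/
theorem holderQuotient_of_pairBound {Δ B K S t m β : ℝ} (ht : 0 < t) (hm : 0 < m)
    (h : Δ ≤ B * (K * t ^ β) * S * (m ^ 2)⁻¹) :
    Δ * ((t * m) ^ β)⁻¹ ≤ B * K * S * ((m ^ 2)⁻¹ * (m ^ β)⁻¹) := by
  have htβ : 0 < t ^ β := Real.rpow_pos_of_pos ht β
  have hmβ : 0 < m ^ β := Real.rpow_pos_of_pos hm β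
  have hprod : (t * m) ^ β = t ^ β * m ^ β := Real.mul_rpow ht.le hm.le
  rw [hprod, mul_inv]
  have hq : 0 ≤ (t ^ β)⁻¹ * (m ^ β)⁻¹ := mul_nonneg (inv_nonneg.2 htβ.le) (inv_nonneg.2 hmβ.le)
  calc Δ * ((t ^ β)⁻¹ * (m ^ β)⁻¹) ≤ B * (K * t ^ β) * S * (m ^ 2)⁻¹ * ((t ^ β)⁻¹ * (m ^ β)⁻¹) :=
        mul_le_mul_of_nonneg_right h hq
    _ = B * K * S * ((m ^ 2)⁻¹ * (m ^ β)⁻¹) * (t ^ β * (t ^ β)⁻¹) := by ring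
    _ = B * K * S * ((m ^ 2)⁻¹ * (m ^ β)⁻¹) := by rw [mul_inv_cancel₀ htβ.ne', mul_one]

end Quotient


/-! ## §6  (v1.1) The socket fed by p22's H2: the Hölder member of (1.36)/(1.62) modulo the PER-CUBE HÖLDER FIRST LEGS only -/

section OfLegs

open B6Cover236MultiLevelBlocks (cubes)
open B6RandomWalk (delta3 delta3_pos)
open B6Prop26Gluing (mulOp ind)
open B6Prop26KLevelSkeletonV1 (hB)
open B6Prop26KLevelSkeletonV2 (SbigT)
open B6CubeWindowV1 (Placed Gl band_le one_le_of_eight_le four_le_of_five_le)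
open B6Prop26HolderGradKLevelV1 (prop26_2137_grad_kLevel_of_legs)

open Classical in
/-- **THE HÖLDER MEMBER OF (1.36)/(1.62) FOR THEOREM 4's `A = A′ − ∂λ` AT `U₀ = 1` ON THE `k`-LEVEL V1 TORUS, MODULO THE PER-CUBE HÖLDER FIRST LEGS
ONLY** — §4 `thm4_holder_member_V1` with its pair-majorant hypothesis DISCHARGED by p22's `B6Prop26HolderGradKLevelV1.prop26_2137_grad_kLevel_of_legs`
((2.137)₁ at `k` levels for the genuine `G` from the first legs of the walk (2.141), p374136), fed VERBATIM with the Hölder weight `Pw(y) = τ·(L^{j(y)}·|c′|⁻¹)`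
(p22's intended instance, `τ = t^β`): for the band `0 < b₀ ≤ b₁` and a legs-rate `ρ_H > 0` there is `σ₁ > 0` (`≤ ρ_H`) such that for all `0 < σ ≤ σ₁`,
`0 < β < 1` there are `A ≥ 0`, `M₂ > 0` (p22's), `B₀ ≥ 1`, `N₁ ≥ 1` (this file's, at the rate `δ₃ = delta3 β (2σ) = (1 − β)σ`) with: on every admissible
V1 torus (`k ≥ 2`, `M_h = Lᵃ ≥ 8`, `M₂ ≤ L·M_h`, `N₁ + 1 ≤ R·L·M_h`, `R ≥ 2L²`, `P′ ≥ 5`, `L ≥ 5`, all cubes placed, `c′ ≠ 0`, weights in the band), for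
every `α₀, α₁ ≥ 0`, perturbation `A′` with the processed (1.34)/(1.66) sizes, restricted `λ ∈ N(Q′)` in the Landau gauge, direction `ν`, pair `(x, x′)`,
`C_H ≥ 0`, `τ ≥ 0`: IF every cube's first leg satisfies p22's displayed hypothesis `HasMajorant (P_{x,x′}·∇_ν·(h_□G_□h_□)) (1_{□̃}(y)·C_H·(τ·(L^{j(y)}|c′|⁻¹))·
e^{−ρ_H d_T})`, THEN `A := A′ − ∂λ` satisfies `|(∇_νA)(x) − (∇_νA)(x′)| ≦ 2dL·B₀·(A·C_H·τ)·(1 + 2b₁)·(α₀ + α₁)·((L^{j(x)})η)⁻²` (`η = |c′|⁻¹`).  What is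
left displayed is EXACTLY the tree's remaining [B6]-side input of the `k`-level (2.137)₁ (p22/p38's lane).
[cite: Balaban1985RegularSpaces, (1.36) p.82, (1.62) + Prop. 3 p.87, Thm 4 p.88, (1.58) p.86; Balaban1984PropagatorsII, Prop. 2.6 (2.137) p.247, (2.141) p.247, (2.16) p.225; Balaban1984PropagatorsI, (1.109) p.35] -/
theorem thm4_holder_member_V1_of_legs (d ℓ : ℕ) (hd : 1 ≤ d + 1) (hL : Odd (ℓ + 1) ∧ 1 < ℓ + 1) {b₀ b₁ : ℝ} (hb₀ : 0 < b₀) (hb₁ : b₀ ≤ b₁)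
    {ρH : ℝ} (hρH : 0 < ρH) :
    ∃ σ₁ : ℝ, 0 < σ₁ ∧ σ₁ ≤ ρH ∧ ∀ (σ : ℝ), 0 < σ → σ ≤ σ₁ → ∀ (β : ℝ), 0 < β → β < 1 →
    ∃ A M₂ B₀ : ℝ, ∃ N₁ : ℕ, 0 ≤ A ∧ 0 < M₂ ∧ 1 ≤ B₀ ∧ 0 < N₁ ∧
    ∀ (m K : ℕ) {Mh k R : ℕ} {P' : Fin (d + 1) → ℕ}
      (hN : ∀ μ, N0 ℓ Mh k P' μ = (PV d ℓ m K hd hL).sitesPerDir 0) (D : TDomains d ℓ Mh k P' R) (hk : k ≤ m + K) (_ : 2 ≤ k)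
      {a : ℕ} (hMha : Mh = (ℓ + 1) ^ a) (hM8 : 8 ≤ Mh) (_ : 2 * (ℓ + 1) ^ 2 ≤ R) (hP5 : ∀ μ, 5 ≤ P' μ) (_ : 4 ≤ ℓ)
      (hpl : ∀ c : ↥(cubes D.toDomains), Placed ℓ k P' c.1) (_ : M₂ ≤ ((ℓ : ℝ) + 1) * Mh) (_ : N₁ + 1 ≤ R * ((ℓ + 1) * Mh))
      {cf : ℝ} (hcf : cf ≠ 0) {w : BondIdx (domT hN D hk) → ℝ} (hw : ∀ i, 0 < w i) (_ : GlobalBand b₀ b₁ cf w),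
      ∀ (A' : BondSpace (PV d ℓ m K hd hL)) (α₀ α₁ : ℝ), 0 ≤ α₀ → 0 ≤ α₁ →
        (∀ b, |dcsE cf (dcE cf A') b| ≤ 2 * α₀ * (((geomT D).len (blkV1 hN D b) * |cf|⁻¹) ^ 3)⁻¹) →
        (∀ i, |QE (domT hN D hk) A' i| ≤ 2 * ((d : ℝ) + 1) * ((ℓ : ℝ) + 1) * α₁ * (((ℓ : ℝ) + 1) ^ (i.1.1 : ℕ) * |cf|⁻¹)⁻¹) →
      ∀ n : ScalarSpace (PV d ℓ m K hd hL), n ∈ LinearMap.ker (QpE (domT hN D hk)) →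
        RE (domT hN D hk) cf (dsE cf (A' - dE cf n)) = 0 →
      ∀ (ν : Fin (d + 1)) (x x' : PBond (PV d ℓ m K hd hL) 0) (CH τ : ℝ), 0 ≤ CH → 0 ≤ τ →
        -- p22's displayed per-cube Hölder first legs, for the Hölder weight `Pw(y) = τ·(L^{j(y)}·|c′|⁻¹)`
        (∀ c : ↥(cubes D.toDomains), HasMajorant (g := geomT D) (blkV1 hN D)
          (pairOp x x' * DV (P := PV d ℓ m K hd hL) ν cf *
            (mulOp (hB hN D c) *
              Gl hN hk (one_le_of_eight_le hM8) (four_le_of_five_le hP5) hMha c (band_le (d := d) (ℓ := ℓ) hb₀ hb₁) (hpl c) w cf *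
              mulOp (hB hN D c)))
          (fun y y' => ind (SbigT D (one_le_of_eight_le hM8) (four_le_of_five_le hP5) c) y *
            (CH * (τ * ((geomT D).len y * |cf|⁻¹)) * Real.exp (-(ρH * (geomT D).dist y y'))))) →
        |DV (P := PV d ℓ m K hd hL) ν cf (WithLp.ofLp (A' - dE cf n)) x -
            DV (P := PV d ℓ m K hd hL) ν cf (WithLp.ofLp (A' - dE cf n)) x'| ≤
          2 * ((d : ℝ) + 1) * ((ℓ : ℝ) + 1) * B₀ * (A * CH * τ) * (1 + 2 * b₁) * (α₀ + α₁) *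
            (((geomT D).len (blkV1 hN D x) * |cf|⁻¹) ^ 2)⁻¹ := by
  obtain ⟨σ₁, hσ₁, hσ₁ρ, h2⟩ := prop26_2137_grad_kLevel_of_legs d ℓ hd hL hb₀ hb₁ hρH
  refine ⟨σ₁, hσ₁, hσ₁ρ, fun σ hσ hσ1 β hβ hβ1 => ?_⟩
  obtain ⟨A, M₂, hA, hM₂, hlegs2⟩ := h2 σ hσ hσ1 β hβ hβ1.le
  -- this file's constants at the rate `δ₃ = delta3 β (2σ) = (1 − β)σ > 0`
  have hδ : 0 < delta3 β (2 * σ) := delta3_pos hβ1 (by linarith)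
  obtain ⟨B₀, N₁, hB₀, hN₁, h4⟩ := thm4_holder_member_V1 d ℓ hδ
  refine ⟨A, M₂, B₀, N₁, hA, hM₂, hB₀, hN₁, ?_⟩
  intro m K Mh k R P' hN D hk hk2 a hMha hM8 hR2 hP5 hℓ hpl hM hRM cf hcf w hw hwb A' α₀ α₁ hα₀ hα₁ hJ hB n hn hLan ν x x' CH τ hCH hτ hlegs
  have hMh1 : 1 ≤ Mh := one_le_of_eight_le hM8
  have hP1 : ∀ μ, 1 ≤ P' μ := fun μ => le_trans (by norm_num) (hP5 μ)
  have hb₁0 : 0 ≤ b₁ := hb₀.le.trans hb₁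
  -- p22's (2.137)₁ at `k` levels from the legs, with the weight `Pw(y) = τ·(L^{j(y)}·|c′|⁻¹)`
  have hPw : ∀ y : (geomT D).Site, 0 ≤ τ * ((geomT D).len y * |cf|⁻¹) := fun y =>
    mul_nonneg hτ (mul_nonneg (lenT_pos D y).le (inv_nonneg.2 (abs_nonneg cf)))
  have hpair := (hlegs2 m K hN D hk hk2 hMha hM8 hR2 hP5 hℓ hpl hM hcf hw hwb ν x x' CH (fun y => τ * ((geomT D).len y * |cf|⁻¹))
    hCH hPw hlegs).1
  -- rewritten in the socket's letters `C_P·((Lʲ)η)·e^{−δ₃d_T}`, `C_P = A·C_H·τ`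
  have hpair' : HasMajorant (g := geomT D) (blkV1 hN D)
      (pairOp x x' * DV (P := PV d ℓ m K hd hL) ν cf * onFun (GE (domT hN D hk) hcf hw))
      (fun y y' => A * CH * τ * ((geomT D).len y * |cf|⁻¹) * Real.exp (-(delta3 β (2 * σ) * (geomT D).dist y y'))) :=
    hasMajorant_mono (g := geomT D) (blkV1 hN D) hpair fun y y' => le_of_eq (by ring)
  exact h4 k Mh R hMh1 hRM P' hP1 D m K hd hL hN hk cf hcf w hw b₀ b₁ hb₀.le hb₁0 hwb A' α₀ α₁ hα₀ hα₁ hJ hB n hn hLan ν x x'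
    (A * CH * τ) (mul_nonneg (mul_nonneg hA hCH) hτ) hpair'

end OfLegs


/-! ## §7  (v1.1) Theorem 2 at `U₀ = 1` on the `k`-level V1 torus with the COMPLETE conclusion list (1.36)–(1.39): the four sup members of
`B8Thm4MultiLevelTorus.thm4_multiLevelTorus_V1` AND the Hölder member of §4, modulo the (2.137)₁ pair majorant -/

section Thm2Five

open B8Thm4MultiLevelTorus (thm4_multiLevelTorus_V1)
open B8ScaledSupNorm (msup)
open LatticeFieldCalculus (laplace)

open Classical in
/-- **THEOREM 2 AT `U₀ = 1` ON THE `k`-LEVEL V1 TORUS WITH THE COMPLETE CONCLUSION LIST (1.36)–(1.39)** (p. 83: *"there exists exactly one gauge transformation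
u satisfying (1.29) and such that the conditions (1.36)–(1.39) hold for the configuration U₁ = U′^{u⁻¹}"*; (1.36) has THREE members, the third being
`‖A‖_{1,β} < B₂(β₀)(α₀ + α₁)(Lʲη)^{−2−β}`) — the `k`-level twin of gen 46's `B8Eq136HolderFlatTorus.thm2_flat_five`: own `thm4_multiLevelTorus_V1` (p383020;
∃! restricted Landau `λ`, (1.37), the sup members `|A|₍₋₁₎`, `|∇A|₍₋₂₎`, (1.39) `|D*DA|`, `|ΔA|₍₋₃₎` with `B₁ = 5dL·B₀′`) AND §4 `thm4_holder_member_V1` (the Hölder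
member, `B₂ ↔ 2dL·B_H·C_P·(1 + 2b₁)`, MODULO the (2.137)₁ pair majorant at the rate `σ_H`) in ONE sentence: for the band `0 < b₀ ≤ b₁` and a Hölder rate
`σ_H > 0` there is `σ₀ > 0` such that for all `σ ∈ (0, σ₀]`, `α ∈ (0, 1)` there are `B₁ ≥ 1`, `M₄ > 0` (thm4's) and `B_H ≥ 1`, `N₁ ≥ 1` (§4's) with: on every
admissible `k`-level V1 torus (`k ≥ 1`, `M_h = Lᵃ ≥ 8`, `R ≥ 2L²`, `P′ ≥ 5L`, `L ≥ 5`, `M₄ ≤ L·M_h`, `N₁ + 1 ≤ R·L·M_h`, `c′ ≠ 0`, weights in the band), for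
every `α₀, α₁ ≥ 0` and `A′` with the processed (1.34)/(1.66) sizes: ∃! `λ ∈ N(Q′)` with `R∂*(A′ − ∂λ) = 0`, and for every such `λ`, `A := A′ − ∂λ` satisfies
(1.37) `QA = QA′`, (1.36) `|A|₍₋₁₎, |∇A|₍₋₂₎ ≦ B₁(α₀ + α₁)`, (1.39) `|(D*DA)(b)| ≦ B₁(α₀ + α₁)(L^{j(b)}η)⁻³`, `|ΔA|₍₋₃₎ ≦ B₁(α₀ + α₁)`, AND, for every
direction `ν`, pair `(x, x′)` and `C_P ≥ 0` carrying the (2.137)₁ pair majorant of `P_{x,x′}·∇_ν·onFun G(1)` at the rate `σ_H`, the Hölder member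
`|(∇_νA)(x) − (∇_νA)(x′)| ≦ 2dL·B_H·C_P·(1 + 2b₁)(α₀ + α₁)((L^{j(x)})η)⁻²`.  (v1.2 note, ref-4 D-g107-1:) print's Theorem 2 carries the
threshold *"with α₀ + α₁ ≦ c₁"* (p. 83); as declared in §4 and in `B8Thm4MultiLevelTorus`, that threshold is NOT needed in the linear chart at
`U₀ = 1` and is NOT assumed here — the statement is stronger for omitting it (the same holds for §11).
[cite: Balaban1985RegularSpaces, Thm 2 p.83, (1.36)–(1.38) p.82, (1.39) p.83, (1.62) + Prop. 3 p.87, Thm 4 p.88, (1.29) p.81; Balaban1984PropagatorsII, Prop. 2.6 (2.136)–(2.137) p.247, (2.7) p.224, (2.12) p.225; Balaban1984PropagatorsI, (1.109) p.35] -/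
theorem thm2_multiLevelTorus_V1_five (d ℓ : ℕ) (hd : 1 ≤ d + 1) (hL : Odd (ℓ + 1) ∧ 1 < ℓ + 1) {b₀ b₁ : ℝ} (hb₀ : 0 < b₀) (hb₁ : b₀ ≤ b₁)
    {σH : ℝ} (hσH : 0 < σH) :
    ∃ σ₀ : ℝ, 0 < σ₀ ∧ ∀ (σ : ℝ), 0 < σ → σ ≤ σ₀ → ∀ (α : ℝ), 0 < α → α < 1 →
    ∃ B₁ M₄ BH : ℝ, ∃ N₁ : ℕ, 1 ≤ B₁ ∧ 0 < M₄ ∧ 1 ≤ BH ∧ 0 < N₁ ∧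
    ∀ (m K : ℕ) {Mh k R : ℕ} {P' : Fin (d + 1) → ℕ}
      (hN : ∀ μ, N0 ℓ Mh k P' μ = (PV d ℓ m K hd hL).sitesPerDir 0) (D : TDomains d ℓ Mh k P' R) (hk : k ≤ m + K) (_ : 1 ≤ k)
      {a : ℕ} (_ : Mh = (ℓ + 1) ^ a) (_ : 8 ≤ Mh) (_ : 2 * (ℓ + 1) ^ 2 ≤ R) (_ : ∀ μ, 5 * (ℓ + 1) ≤ P' μ) (_ : 4 ≤ ℓ)
      (_ : M₄ ≤ ((ℓ : ℝ) + 1) * Mh) (_ : N₁ + 1 ≤ R * ((ℓ + 1) * Mh))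
      {cf : ℝ} (hcf : cf ≠ 0) {w : BondIdx (domT hN D hk) → ℝ} (hw : ∀ i, 0 < w i) (_ : GlobalBand b₀ b₁ cf w),
      ∀ (A' : BondSpace (PV d ℓ m K hd hL)) (α₀ α₁ : ℝ), 0 ≤ α₀ → 0 ≤ α₁ →
        (∀ b, |dcsE cf (dcE cf A') b| ≤ 2 * α₀ * (((geomT D).len (blkV1 hN D b) * |cf|⁻¹) ^ 3)⁻¹) →
        (∀ i, |QE (domT hN D hk) A' i| ≤ 2 * ((d : ℝ) + 1) * ((ℓ : ℝ) + 1) * α₁ * (((ℓ : ℝ) + 1) ^ (i.1.1 : ℕ) * |cf|⁻¹)⁻¹) →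
        -- «exactly one gauge transformation u satisfying (1.29) and … (1.38)»
        (∃! n : ScalarSpace (PV d ℓ m K hd hL),
            n ∈ LinearMap.ker (QpE (domT hN D hk)) ∧ RE (domT hN D hk) cf (dsE cf (A' - dE cf n)) = 0) ∧
        ∀ n : ScalarSpace (PV d ℓ m K hd hL), n ∈ LinearMap.ker (QpE (domT hN D hk)) →
          RE (domT hN D hk) cf (dsE cf (A' - dE cf n)) = 0 →
          -- (1.37)
          QE (domT hN D hk) (A' - dE cf n) = QE (domT hN D hk) A' ∧
          -- (1.36) sup members
          msup (ℓ + 1) k |cf|⁻¹ (-1) (fun j (b : PBond (PV d ℓ m K hd hL) 0) => j ≤ (blkV1 hN D b).1.1) (WithLp.ofLp (A' - dE cf n)) ≤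
              B₁ * (α₀ + α₁) ∧
          msup (ℓ + 1) k |cf|⁻¹ (-2) (fun j (p : Fin (d + 1) × PBond (PV d ℓ m K hd hL) 0) => j ≤ (blkV1 hN D p.2).1.1)
              (fun p : Fin (d + 1) × PBond (PV d ℓ m K hd hL) 0 => DV (P := PV d ℓ m K hd hL) p.1 cf (WithLp.ofLp (A' - dE cf n)) p.2) ≤
              B₁ * (α₀ + α₁) ∧
          -- (1.39)
          (∀ b : PBond (PV d ℓ m K hd hL) 0,
              |dcsE cf (dcE cf (A' - dE cf n)) b| ≤ B₁ * (α₀ + α₁) * (((geomT D).len (blkV1 hN D b) * |cf|⁻¹) ^ 3)⁻¹) ∧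
          msup (ℓ + 1) k |cf|⁻¹ (-3) (fun j (b : PBond (PV d ℓ m K hd hL) 0) => j ≤ (blkV1 hN D b).1.1)
              (fun b : PBond (PV d ℓ m K hd hL) 0 => laplace cf (fun z => (A' - dE cf n) ⟨z, b.dir⟩) b.src) ≤ B₁ * (α₀ + α₁) ∧
          -- (1.36) the Hölder member, per pair, modulo the (2.137)₁ pair majorant at the rate `σ_H`
          (∀ (ν : Fin (d + 1)) (x x' : PBond (PV d ℓ m K hd hL) 0) (CP : ℝ), 0 ≤ CP →
            HasMajorant (g := geomT D) (blkV1 hN D)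
              (pairOp x x' * DV (P := PV d ℓ m K hd hL) ν cf * onFun (GE (domT hN D hk) hcf hw))
              (fun y y' => CP * ((geomT D).len y * |cf|⁻¹) * Real.exp (-(σH * (geomT D).dist y y'))) →
            |DV (P := PV d ℓ m K hd hL) ν cf (WithLp.ofLp (A' - dE cf n)) x -
                DV (P := PV d ℓ m K hd hL) ν cf (WithLp.ofLp (A' - dE cf n)) x'| ≤
              2 * ((d : ℝ) + 1) * ((ℓ : ℝ) + 1) * BH * CP * (1 + 2 * b₁) * (α₀ + α₁) *
                (((geomT D).len (blkV1 hN D x) * |cf|⁻¹) ^ 2)⁻¹) := by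
  obtain ⟨σ₀, hσ₀, h4⟩ := thm4_multiLevelTorus_V1 d ℓ hd hL hb₀ hb₁
  obtain ⟨BH, N₁, hBH, hN₁, hH⟩ := thm4_holder_member_V1 d ℓ hσH
  refine ⟨σ₀, hσ₀, fun σ hσ hσle α hα0 hα1 => ?_⟩
  obtain ⟨B₀', M₄, hB₀', hM₄, h⟩ := h4 σ hσ hσle α hα0 hα1
  have hdL : (1 : ℝ) ≤ ((d : ℝ) + 1) * ((ℓ : ℝ) + 1) :=
    one_le_mul_of_one_le_of_one_le (le_add_of_nonneg_left (Nat.cast_nonneg d)) (le_add_of_nonneg_left (Nat.cast_nonneg ℓ))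
  refine ⟨5 * ((d : ℝ) + 1) * ((ℓ : ℝ) + 1) * B₀', M₄, BH, N₁, ?_, hM₄, hBH, hN₁, ?_⟩
  · calc (1 : ℝ) ≤ 5 * (((d : ℝ) + 1) * ((ℓ : ℝ) + 1)) * 1 := by linarith
      _ ≤ 5 * (((d : ℝ) + 1) * ((ℓ : ℝ) + 1)) * B₀' := mul_le_mul_of_nonneg_left hB₀' (by positivity)
      _ = 5 * ((d : ℝ) + 1) * ((ℓ : ℝ) + 1) * B₀' := by ring
  intro m K Mh k R P' hN D hk hk1 a hMha hM8 hR2 hP hℓ4 hM4t hRM cf hcf w hw hwb A' α₀ α₁ hα₀ hα₁ hJ hB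
  obtain ⟨hex, hall⟩ := h m K hN D hk hk1 hMha hM8 hR2 hP hℓ4 hM4t hcf hw hwb A' α₀ α₁ hα₀ hα₁ hJ hB
  refine ⟨hex, fun n hn hLan => ?_⟩
  obtain ⟨h37, _, hA1, hA2, hJ3, hA4, _, _, _⟩ := hall n hn hLan
  have hMh1 : 1 ≤ Mh := le_trans (by norm_num) hM8
  have hP1 : ∀ μ, 1 ≤ P' μ := fun μ => le_trans (by omega) (hP μ)
  refine ⟨h37, hA1, hA2, hJ3, hA4, fun ν x x' CP hCP hPair => ?_⟩
  exact hH k Mh R hMh1 hRM P' hP1 D m K hd hL hN hk cf hcf w hw b₀ b₁ hb₀.le (hb₀.le.trans hb₁) hwb A' α₀ α₁ hα₀ hα₁ hJ hB n hn hLan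
    ν x x' CP hCP hPair

end Thm2Five


/-! ## §8  (v1.1) Proposition 3's Hölder member IN PROPOSITION 3's OWN SETTING (the (1.55)/(1.56) size lines with `α₂`, `C₂`, the restriction (1.61)):
print's constant shape «5dL·B₀(β)·(α₀ + α₁)», the `|∇A|₍₋₂₎`-term of (1.55) bootstrapped through own `prop3_multiLevelTorus_V1_P26_vector` -/

section Prop3Holder

open B8Prop3MultiLevelTorusP26 (prop3_multiLevelTorus_V1_P26_vector)
open B8ScaledSupNorm (msup)

open Classical in
/-- **PROPOSITION 3's HÖLDER MEMBER «‖A‖_{1,β} < 5dLB₀(β)(α₀ + α₁)(Lʲη)^{−2−β}» AT `U₀ = 1` ON THE `k`-LEVEL V1 TORUS IN PROPOSITION 3's OWN SETTING, MODULO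
THE (2.137)₁ PAIR MAJORANT** (p. 87: *"then U₁ satisfies (1.36)–(1.39) with B₁ = 5dLB₀, B₂(β₀) = 5dLB₀(β₀)"*; p. 86: *"Let us take this bound for |∇^η_{U₀}A|₍₋₂₎ on
the left-hand side, and let us assume that B₀36dα₂ ≦ 1/2"*, (1.61)): own hypothesis-free `prop3_multiLevelTorus_V1_P26_vector` (v1.5, p368650: the four sup
members ≦ `5d_PL_PB₀′(α₀ + α₁)`, `B₀′ = K_L(B₀A + 1)(1 + 2b₁)`) supplies the bootstrap of the `|∇A|₍₋₂₎`-term of (1.55), §3 `ineq159_holder_member_pref` the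
Hölder numerator `≦ B_H·C_P·(1 + 2b₁)(|J|₍₋₃₎ + |B₁|)((L^{j(x)})η)⁻²`, and the printed arithmetic (1.59) ⟹ (1.60) ⟹ (1.62) gives `|J|₍₋₃₎ + |B₁| ≦ 5d_PL_P(α₀ + α₁)`:
for the band `0 < b₀ ≤ b₁` and a Hölder rate `σ_H > 0` there is `σ₀ > 0` and for all `σ ∈ (0, σ₀]`, `α ∈ (0, 1)` constants `B₀, K_L ≥ 1`, `A ≥ 0`, `M₄ > 0`
(as in `_vector`), `B_H ≥ 1`, `N₁ ≥ 1` (§3 at the rate `σ_H`) such that on every admissible `k`-level V1 torus (`_vector`'s binders + `N₁ + 1 ≤ R·L·M_h`), for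
every `A` with (1.55) `∂*∂A = J`, (1.42) `R∂*A = 0`, (1.56) `QA = B`, sizes `|J(b)| ≦ n_J((L^{j(b)})η)⁻³`, `|B_{(j,c)}| ≦ n_B((Lʲ)η)⁻¹` and reals `d_P ≥ 0`,
`L_P` (`d_PL_P ≥ 1`), `C₂`, `α₀, α₁, α₂ ≥ 0` subject to the (1.55) size line «n_J ≦ 2α₀ + 36dα₂|∇A|₍₋₂₎ + 50dα₂³ + 10dα₀α₂», the (1.56) line «n_B ≦ 2dLα₁ +
C₂α₂²», «B₀′36dα₂ ≦ ½», `50dα₂ ≤ 1` and (1.61), and for every direction `ν`, pair `(x, x′)`, `C_P ≥ 0` with the §3 pair majorant at the rate `σ_H`: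
**`|(∇_νA)(x) − (∇_νA)(x′)| ≦ 5d_PL_P·B_H·C_P·(1 + 2b₁)·(α₀ + α₁)·((L^{j(x)})η)⁻²`** — with `C_P = O(1)t^β` and §5, print's `B₂(β) = 5dL·B₀(β)`,
`B₀(β) = B_H·O(1)·(1 + 2b₁)`.
[cite: Balaban1985RegularSpaces, Prop. 3 p.87, (1.62) p.87, (1.59)–(1.61) p.86, (1.55)–(1.56) p.86, (1.36) p.82; Balaban1984PropagatorsII, Prop. 2.6 (2.136)–(2.137) p.247, (2.16) p.225; Balaban1984PropagatorsI, (1.109) p.35; Balaban1985BackgroundPropagators, Theorem 3.3 p.399] -/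
theorem prop3_holder_member_V1_P26 (d ℓ : ℕ) (hd : 1 ≤ d + 1) (hL : Odd (ℓ + 1) ∧ 1 < ℓ + 1) {b₀ b₁ : ℝ} (hb₀ : 0 < b₀) (hb₁ : b₀ ≤ b₁)
    {σH : ℝ} (hσH : 0 < σH) :
    ∃ σ₀ : ℝ, 0 < σ₀ ∧ ∀ (σ : ℝ), 0 < σ → σ ≤ σ₀ → ∀ (α : ℝ), 0 < α → α < 1 →
    ∃ B₀ KL : ℝ, 1 ≤ B₀ ∧ 1 ≤ KL ∧
    ∃ Amaj M₄ BH : ℝ, ∃ N₁ : ℕ, 0 ≤ Amaj ∧ 0 < M₄ ∧ 1 ≤ BH ∧ 0 < N₁ ∧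
    ∀ (m K : ℕ) {Mh k R : ℕ} {P' : Fin (d + 1) → ℕ}
      (hN : ∀ μ, N0 ℓ Mh k P' μ = (PV d ℓ m K hd hL).sitesPerDir 0) (D : TDomains d ℓ Mh k P' R) (hk : k ≤ m + K) (_ : 1 ≤ k)
      {a : ℕ} (_ : Mh = (ℓ + 1) ^ a) (_ : 8 ≤ Mh) (_ : 2 * (ℓ + 1) ^ 2 ≤ R) (_ : ∀ μ, 5 * (ℓ + 1) ≤ P' μ) (_ : 4 ≤ ℓ)
      (_ : M₄ ≤ ((ℓ : ℝ) + 1) * Mh) (_ : N₁ + 1 ≤ R * ((ℓ + 1) * Mh))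
      {cf : ℝ} (hcf : cf ≠ 0) {w : BondIdx (domT hN D hk) → ℝ} (hw : ∀ i, 0 < w i) (_ : GlobalBand b₀ b₁ cf w),
      ∀ (A J : BondSpace (PV d ℓ m K hd hL)) (B : BondIdxSpace (domT hN D hk)),
        dcsE cf (dcE cf A) = J → RE (domT hN D hk) cf (dsE cf A) = 0 → QE (domT hN D hk) A = B →
        ∀ (nJ nB : ℝ), 0 ≤ nJ → 0 ≤ nB →
          (∀ b, |J b| ≤ nJ * (((geomT D).len (blkV1 hN D b) * |cf|⁻¹) ^ 3)⁻¹) →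
          (∀ i, |B i| ≤ nB * (((ℓ : ℝ) + 1) ^ (i.1.1 : ℕ) * |cf|⁻¹)⁻¹) →
        ∀ (dP LP C₂ α₀ α₁ α₂ : ℝ), 0 ≤ dP → 1 ≤ dP * LP → 0 ≤ α₀ → 0 ≤ α₁ → 0 ≤ α₂ →
          -- (1.55) size line with the `|∇A|₍₋₂₎`-term
          nJ ≤ 2 * α₀ + 36 * dP * α₂ *
              msup (ℓ + 1) k |cf|⁻¹ (-2) (fun j (p : Fin (d + 1) × PBond (PV d ℓ m K hd hL) 0) => j ≤ (blkV1 hN D p.2).1.1)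
                (fun p : Fin (d + 1) × PBond (PV d ℓ m K hd hL) 0 => DV (P := PV d ℓ m K hd hL) p.1 cf (WithLp.ofLp A) p.2) +
            50 * dP * α₂ ^ 3 + 10 * dP * α₀ * α₂ →
          -- (1.56) size line
          nB ≤ 2 * dP * LP * α₁ + C₂ * α₂ ^ 2 →
          -- «B₀36dα₂ ≦ 1/2» (for `B₀′`), `50dα₂ ≤ 1`, (1.61)
          36 * dP * (KL * ((B₀ * Amaj + 1) * (1 + 2 * b₁))) * α₂ ≤ 1 / 2 → 50 * dP * α₂ ≤ 1 →
          2 * α₂ ^ 2 + 20 * dP * α₀ * α₂ + 2 * C₂ * α₂ ^ 2 ≤ α₀ + α₁ →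
        ∀ (ν : Fin (d + 1)) (x x' : PBond (PV d ℓ m K hd hL) 0) (CP : ℝ), 0 ≤ CP →
          HasMajorant (g := geomT D) (blkV1 hN D)
            (pairOp x x' * DV (P := PV d ℓ m K hd hL) ν cf * onFun (GE (domT hN D hk) hcf hw))
            (fun y y' => CP * ((geomT D).len y * |cf|⁻¹) * Real.exp (-(σH * (geomT D).dist y y'))) →
          |DV (P := PV d ℓ m K hd hL) ν cf (WithLp.ofLp A) x - DV (P := PV d ℓ m K hd hL) ν cf (WithLp.ofLp A) x'| ≤
            5 * dP * LP * BH * CP * (1 + 2 * b₁) * (α₀ + α₁) * (((geomT D).len (blkV1 hN D x) * |cf|⁻¹) ^ 2)⁻¹ := by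
  obtain ⟨σ₀, hσ₀, hV⟩ := prop3_multiLevelTorus_V1_P26_vector d ℓ hd hL hb₀ hb₁
  obtain ⟨BH, N₁, hBH, hN₁, hH⟩ := ineq159_holder_member_pref d ℓ hσH
  refine ⟨σ₀, hσ₀, fun σ hσ hσle α hα0 hα1 => ?_⟩
  obtain ⟨B₀, KL, hB₀, hKL, Amaj, M₄, hA, hM₄, hP3⟩ := hV σ hσ hσle α hα0 hα1
  refine ⟨B₀, KL, hB₀, hKL, Amaj, M₄, BH, N₁, hA, hM₄, hBH, hN₁, ?_⟩
  intro m K Mh k R P' hN D hk hk1 a hMha hM8 hR2 hP hℓ4 hM4t hRM cf hcf w hw hwb A J B h55 h42 h56 nJ nB hnJ hnB hJ hB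
    dP LP C₂ α₀ α₁ α₂ hdP hdL hα₀ hα₁ hα₂ h55s h56s hside h50 h61 ν x x' CP hCP hPair
  -- the bootstrap of `g = |∇A|₍₋₂₎` from the hypothesis-free Proposition 3 (v1.5 `_vector`)
  obtain ⟨-, hg, -, -, -, -, -⟩ := hP3 m K hN D hk hk1 hMha hM8 hR2 hP hℓ4 hM4t hcf hw hwb A J B h55 h42 h56 nJ nB hnJ hnB hJ hB
    dP LP C₂ α₀ α₁ α₂ hdP hdL hα₀ hα₁ hα₂ h55s h56s hside h50 h61
  set B₀' : ℝ := KL * ((B₀ * Amaj + 1) * (1 + 2 * b₁))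
  set g : ℝ := msup (ℓ + 1) k |cf|⁻¹ (-2) (fun j (p : Fin (d + 1) × PBond (PV d ℓ m K hd hL) 0) => j ≤ (blkV1 hN D p.2).1.1)
      (fun p : Fin (d + 1) × PBond (PV d ℓ m K hd hL) 0 => DV (P := PV d ℓ m K hd hL) p.1 cf (WithLp.ofLp A) p.2)
  -- the Hölder numerator from §3 (the window is the band, `η = |c′|⁻¹`)
  have hMh1 : 1 ≤ Mh := le_trans (by norm_num) hM8
  have hP1 : ∀ μ, 1 ≤ P' μ := fun μ => le_trans (by omega) (hP μ)
  have hb₁0 : 0 ≤ b₁ := hb₀.le.trans hb₁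
  have hnum := hH k Mh R hMh1 hRM P' hP1 D m K hd hL hN hk cf hcf w hw b₀ b₁ hb₀.le hb₁0 hwb ν x x' CP hCP hPair A J B h55 h42 h56
    nJ nB hnJ hnB hJ hB
  -- the printed arithmetic (1.59) ⟹ (1.60) ⟹ (1.62): `|J|₍₋₃₎ + |B₁| ≦ 5d_PL_P(α₀ + α₁)`
  have hS : 0 ≤ α₀ + α₁ := add_nonneg hα₀ hα₁
  have hdLP : 0 ≤ dP * LP := by linarith
  -- `36d_Pα₂·g ≦ 36d_Pα₂·5d_PL_PB₀′(α₀ + α₁) ≦ (5/2)d_PL_P(α₀ + α₁)` (the bootstrap with «B₀′36dα₂ ≦ ½»)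
  have h36 : 36 * dP * α₂ * g ≤ 5 / 2 * (dP * LP) * (α₀ + α₁) := by
    have h1 : 36 * dP * α₂ * g ≤ 36 * dP * α₂ * (5 * dP * LP * B₀' * (α₀ + α₁)) :=
      mul_le_mul_of_nonneg_left hg (by positivity)
    have h2 : 36 * dP * α₂ * (5 * dP * LP * B₀' * (α₀ + α₁)) = (36 * dP * B₀' * α₂) * (5 * (dP * LP) * (α₀ + α₁)) := by ring
    have h3 : (36 * dP * B₀' * α₂) * (5 * (dP * LP) * (α₀ + α₁)) ≤ (1 / 2) * (5 * (dP * LP) * (α₀ + α₁)) :=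
      mul_le_mul_of_nonneg_right hside (mul_nonneg (mul_nonneg (by norm_num) hdLP) hS)
    linarith
  -- `50d_Pα₂³ ≦ α₂²` and (1.61): `α₂² + 10d_Pα₀α₂ + C₂α₂² ≦ (α₀ + α₁)/2`
  have h50' : 50 * dP * α₂ ^ 3 ≤ α₂ ^ 2 := by
    have : 50 * dP * α₂ ^ 3 = (50 * dP * α₂) * α₂ ^ 2 := by ring
    rw [this]
    exact (mul_le_mul_of_nonneg_right h50 (sq_nonneg α₂)).trans (by rw [one_mul])
  have hsum : nJ + nB ≤ 5 * dP * LP * (α₀ + α₁) := by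
    nlinarith [mul_nonneg (sub_nonneg.2 hdL) hα₀, mul_nonneg (sub_nonneg.2 hdL) hα₁]
  -- assemble
  have hw2 : (0 : ℝ) ≤ (((geomT D).len (blkV1 hN D x) * |cf|⁻¹) ^ 2)⁻¹ :=
    inv_nonneg.2 (pow_nonneg (mul_nonneg (lenT_pos D _).le (inv_nonneg.2 (abs_nonneg cf))) 2)
  have hfac : 0 ≤ BH * CP * (1 + 2 * b₁) := mul_nonneg (mul_nonneg (by linarith) hCP) (by linarith)
  refine hnum.trans ?_
  calc BH * CP * (1 + 2 * b₁) * (nJ + nB) * (((geomT D).len (blkV1 hN D x) * |cf|⁻¹) ^ 2)⁻¹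
      ≤ BH * CP * (1 + 2 * b₁) * (5 * dP * LP * (α₀ + α₁)) * (((geomT D).len (blkV1 hN D x) * |cf|⁻¹) ^ 2)⁻¹ :=
        mul_le_mul_of_nonneg_right (mul_le_mul_of_nonneg_left hsum hfac) hw2
    _ = 5 * dP * LP * BH * CP * (1 + 2 * b₁) * (α₀ + α₁) * (((geomT D).len (blkV1 hN D x) * |cf|⁻¹) ^ 2)⁻¹ := by ring

end Prop3Holder

/-! ## §9  (v1.2) The [B6] (2.137)₁ PAIR MAJORANT OF `P_{x,x′}·∇_ν·onFun G(D)` WITH NO DISPLAYED INPUT for every odd `L ≥ 5`, `k ≥ 1`, `P′ ≥ 5L`: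
p22's H3b `B6Ineq2137GradKLevelV1.ineq2137_grad_kLevel` (hypothesis-free at `k ≥ 2` with every cube placed) read through p38's padded family
`padT D` (`B6PadLevelV1`: one empty level more, every cube placed, literally the same `G`, blocks, levels, lengths and distance) -/

section Pad2137

open LatticeFieldCalculus (supDist)
open B6RandomWalk (delta3)
open B6PadLevelV1 (padT hN_pad placed_pad sameOm_domT_pad eT eT_blkV1 eT_val dist_eT hasMajorant_of_pad globalBand_pad)
open B6Prop26KLevelAssemblyPadV1 (hLP_of_V1 hP5_of_V1 hk'_of_V1)
open B6Ineq2137GradKLevelV1 (ineq2137_grad_kLevel)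

open Classical in
/-- **[B6] PROPOSITION 2.6 (2.137)₁ — THE PAIR MAJORANT OF `P_{x,x′}·∇_ν·onFun G` FOR THE GENUINE `G = Δ_a⁻¹` OF `D`, EVERY ODD `L ≥ 5`, `k ≥ 1`,
`P′ ≥ 5L`, NO PLACEMENT HYPOTHESIS, NO DISPLAYED INPUT** (p. 247: *"‖ζ∇GJ‖_α, ‖ζG∇*J‖_α ≤ O(1)(Lʲη)^{1−α}(‖ζ‖^ξ_α + |ζ|)e^{−δ₃d(y,y′)}|J|, ξ = L^{−j}
(2.137) for 0 ≤ α < 1 … with the constant O(1) depending on d, L and α (O(1) → ∞ if α → 1)"*; p. 224: *"we admit the case when some domains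
Ω_j are equal to T_η"*): p22's `ineq2137_grad_kLevel` (H3b, first conjunct; binders `k ≥ 2`, `P′ ≥ 5`, every cube `Placed`) applied to the
padded family `padT D` (`k + 1 ≥ 2` levels, `P′ = L·P″` with `P″ = P′/L ≥ 5` — `hLP_of_V1`, `hP5_of_V1`, `hk'_of_V1` —, every cube placed
by `placed_pad`, weights `w ∘ idxB` in the same band by `globalBand_pad`) and transported back: the padded family has literally the same
`G` (`SameOm.GE_eq`), the same blocks and block map of the fine bonds (`eT_blkV1`, hence the same levels `j(y(x))` and the same
admissibility of the pair), the same lengths and the same distance (2.46) (`dist_eT`), so `hasMajorant_of_pad` returns the majorant on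
`blkV1 hN D` verbatim.  Conclusion, in p22's letters (`β` = the walk's Lemma-2.1 exponent, `α` = the Hölder exponent,
`t = |x − x′|_∞/L^{j(y(x))}`): for the band `[b₀, b₁]` there is `σ₁ > 0` and for all `0 < σ ≤ σ₁`, `0 < β ≤ 1`, `0 ≤ α < 1` constants
`A ≥ 0`, `M₂ > 0` such that on every `k`-level V1 torus (`k ≥ 1`, `M_h = Lᵃ ≥ 8`, `R ≥ 2L²`, `P′ ≥ 5L`, `L ≥ 5`, ONE threshold
`M₂ ≤ L·M_h`, `c′ ≠ 0`, weights in the band), for every direction `ν` and admissible pair `(x, x′)` (same direction,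
`|x − x′|_∞ ≤ L^{j(y(x))}`, `|x − x′|_∞ ≤ L^{j(y(x′))}`):
`HasMajorant (P_{x,x′}·∇_ν·onFun G(D)) (A·t^α·(L^{j(y)}·|c′|⁻¹)·e^{−δ₃d_T(y,y′)})`, `δ₃ = delta3 β (2σ)`.  A transport, not a new estimate;
recorded here because this file is its consumer (p22/p38 may export it from their lane; nothing of theirs is restated).
[cite: Balaban1984PropagatorsII, Prop. 2.6 (2.137) p.247, (2.141) p.247, (2.1)–(2.4) p.224, (2.36) p.229, (2.46) p.231, (2.22) p.226; Balaban1984PropagatorsI, (1.109) p.35] -/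
theorem ineq2137_pairMajorant_pad_V1 (d ℓ : ℕ) (hd : 1 ≤ d + 1) (hL : Odd (ℓ + 1) ∧ 1 < ℓ + 1) {b₀ b₁ : ℝ} (hb₀ : 0 < b₀) (hb₁ : b₀ ≤ b₁) :
    ∃ σ₁ : ℝ, 0 < σ₁ ∧ ∀ (σ : ℝ), 0 < σ → σ ≤ σ₁ → ∀ (β : ℝ), 0 < β → β ≤ 1 → ∀ (α : ℝ), 0 ≤ α → α < 1 →
    ∃ A M₂ : ℝ, 0 ≤ A ∧ 0 < M₂ ∧
    ∀ (m K : ℕ) {Mh k R : ℕ} {P' : Fin (d + 1) → ℕ}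
      (hN : ∀ μ, N0 ℓ Mh k P' μ = (PV d ℓ m K hd hL).sitesPerDir 0) (D : TDomains d ℓ Mh k P' R) (hk : k ≤ m + K) (_ : 1 ≤ k)
      {a : ℕ} (_ : Mh = (ℓ + 1) ^ a) (_ : 8 ≤ Mh) (_ : 2 * (ℓ + 1) ^ 2 ≤ R) (_ : ∀ μ, 5 * (ℓ + 1) ≤ P' μ) (_ : 4 ≤ ℓ)
      (_ : M₂ ≤ ((ℓ : ℝ) + 1) * Mh)
      {cf : ℝ} (hcf : cf ≠ 0) {w : BondIdx (domT hN D hk) → ℝ} (hw : ∀ i, 0 < w i) (_ : GlobalBand b₀ b₁ cf w)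
      (ν : Fin (d + 1)) (x x' : PBond (PV d ℓ m K hd hL) 0), x.dir = x'.dir →
      supDist x.src x'.src ≤ (ℓ + 1) ^ (blkV1 hN D x).1.1 → supDist x.src x'.src ≤ (ℓ + 1) ^ (blkV1 hN D x').1.1 →
      HasMajorant (g := geomT D) (blkV1 hN D) (pairOp x x' * DV (P := PV d ℓ m K hd hL) ν cf * onFun (GE (domT hN D hk) hcf hw))
        (fun y y' => A * ((((supDist x.src x'.src : ℕ) : ℝ) / (((ℓ + 1 : ℕ) : ℝ)) ^ (blkV1 hN D x).1.1) ^ α *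
          ((geomT D).len y * |cf|⁻¹)) * Real.exp (-(delta3 β (2 * σ) * (geomT D).dist y y'))) := by
  obtain ⟨σ₁, hσ₁, h⟩ := ineq2137_grad_kLevel d ℓ hd hL hb₀ hb₁
  refine ⟨σ₁, hσ₁, fun σ hσ hσ1 β hβ hβ1 α hα0 hα1 => ?_⟩
  obtain ⟨A, M₂, hA, hM₂, h2⟩ := h σ hσ hσ1 β hβ hβ1 α hα0 hα1
  refine ⟨A, M₂, hA, hM₂, ?_⟩
  intro m K Mh k R P' hN D hk hk1 a hMha hM8 hR2 hP hℓ hM cf hcf w hw hwb ν x x' hdir hs1 hs2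
  -- the padding data `P′ = L·P″`, `P″ ≥ 5`, `k + 1 ≤ m + K` derived from the V1 setting (p38)
  have hLP := hLP_of_V1 hN hMha hP
  have hk' := hk'_of_V1 hN hMha hP
  have hP5 := hP5_of_V1 hP
  have hS := sameOm_domT_pad hN D hk hLP hk'
  have hw' : ∀ i, 0 < (w ∘ hS.idxB) i := fun i => hw _
  -- the block of a fine bond read in the padded family is the relabelled block: same level
  have hbx : ∀ b : PBond (PV d ℓ m K hd hL) 0, (blkV1 (hN_pad hN hLP) (padT D hLP) b).1.1 = (blkV1 hN D b).1.1 := fun b => by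
    rw [← eT_blkV1 D hLP hN, eT_val]
  -- H3b for the padded family (`k + 1 ≥ 2` levels, every cube placed by `placed_pad`), first conjunct
  have hpad := (h2 m K (hN_pad hN hLP) (padT D hLP) hk' (by omega) hMha hM8 hR2 hP5 hℓ (placed_pad D hLP hP5) hM hcf hw'
    (globalBand_pad D hLP hN hk hk' hwb) ν x x' hdir (by rw [hbx]; exact hs1) (by rw [hbx]; exact hs2)).1
  -- the padded family has literally the same `G`
  rw [hS.GE_eq hcf hw hw'] at hpad
  -- the same blocks, block map, levels, lengths and distance
  have hK : (fun a b : (geomT D).Site => A * ((((supDist x.src x'.src : ℕ) : ℝ) / (((ℓ + 1 : ℕ) : ℝ)) ^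
      (blkV1 (hN_pad hN hLP) (padT D hLP) x).1.1) ^ α * ((geomT (padT D hLP)).len (eT D hLP a) * |cf|⁻¹)) *
      Real.exp (-(delta3 β (2 * σ) * (geomT (padT D hLP)).dist (eT D hLP a) (eT D hLP b)))) =
      fun y y' => A * ((((supDist x.src x'.src : ℕ) : ℝ) / (((ℓ + 1 : ℕ) : ℝ)) ^ (blkV1 hN D x).1.1) ^ α *
        ((geomT D).len y * |cf|⁻¹)) * Real.exp (-(delta3 β (2 * σ) * (geomT D).dist y y')) := by
    funext a b
    rw [dist_eT, hbx]
    rfl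
  rw [← hK]
  exact hasMajorant_of_pad D hLP hN hpad

end Pad2137


/-! ## §10  (v1.2) The Hölder member of (1.36)/(1.62) for Theorem 4's `A = A′ − ∂λ` at `U₀ = 1` — NO [B6]-SIDE HYPOTHESIS -/

section Thm4Free

open LatticeFieldCalculus (supDist)
open B6RandomWalk (delta3 delta3_pos)

open Classical in
/-- **THE HÖLDER MEMBER «‖A‖_{1,β} < B₂(β₀)(α₀ + α₁)(Lʲη)^{−2−β}» OF (1.36) p. 82 / (1.62) p. 87 FOR THEOREM 4's `A = A′ − ∂λ` AT `U₀ = 1` ON THE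
`k`-LEVEL V1 TORUS — HYPOTHESIS-FREE** (no [B6]-side input left: §4 `thm4_holder_member_V1` with its (2.137)₁ pair majorant DISCHARGED by §9, i.e.
by p22's `B6Ineq2137GradKLevelV1.ineq2137_grad_kLevel` on the padded family).  In [B8]'s letters (`α` = the [B6] walk exponent of
`thm4_multiLevelTorus_V1`, `β` = the Hölder exponent of (1.36), «β ≦ β₀ < 1»; print's `d, L` = `d + 1`, `ℓ + 1`; `η = |c′|⁻¹`): for the
weight band `0 < b₀ ≤ b₁` there is `σ₁ > 0` such that for all `σ ∈ (0, σ₁]`, `α ∈ (0, 1)`, `β ∈ [0, 1)` there are ONE constant `B₂ ≥ 0`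
(= `2dL·B₀(d, ℓ, δ₃)·A(…, β)·(1 + 2b₁)`, «B₂(β₀) on β₀ also»: [B6]'s `O(1) → ∞ if α → 1`) and ONE size threshold `M₂ > 0` such that on
every admissible `k`-level V1 torus (every odd `L ≥ 5`, `k ≥ 1`, `M_h = Lᵃ ≥ 8`, `R ≥ 2L²`, `P′ ≥ 5L`, `M₂ ≤ L·M_h`, `c′ ≠ 0`, weights in
the band), for every `α₀, α₁ ≥ 0`, every perturbation `A′` with the processed (1.34)/(1.66) sizes `|(∂*∂A′)(b)| ≦ 2α₀(L^{j(b)}η)⁻³`,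
`|(Q_jA′)(c)| ≦ 2dLα₁(Lʲη)⁻¹`, every restricted `λ ∈ N(Q′)` [(1.29)] in the Landau gauge `R∂*(A′ − ∂λ) = 0` [(1.38)], every direction `ν`
and every ADMISSIBLE pair of fine bonds `(x, x′)` (same direction, `|x − x′|_∞ ≤ L^{j(y(x))}`, `|x − x′|_∞ ≤ L^{j(y(x′))}` — print's pairs
of the Hölder norm on `Ω_j` at the scale `ξ = L^{−j}`, [B5] (1.109)), with `t := |x − x′|_∞/L^{j(y(x))} ≤ 1`:
**`|(∇^η_νA)(x) − (∇^η_νA)(x′)| ≦ B₂·t^β·(α₀ + α₁)·((L^{j(y(x))})η)⁻²`** for `A := A′ − ∂λ` — by §5 (`|x − x′| = t·L^{j}η`) exactly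
print's `|x − x′|^{−β}|(∇A)(x) − (∇A)(x′)| ≦ B₂(α₀ + α₁)(Lʲη)^{−2−β}`.  No threshold «α₀ + α₁ ≦ c₁» (not needed in the linear chart), «≦»
for print's «<».
[cite: Balaban1985RegularSpaces, (1.36) p.82, (1.62) + Prop. 3 p.87 («B₂(β₀) = 5dLB₀(β₀) … B₀(β₀) on β₀ also»), Thm 4 p.88, Thm 2 p.83, (1.29) p.81, (1.37)–(1.38) p.82, (1.58) p.86; Balaban1984PropagatorsII, Prop. 2.6 (2.137) p.247, (2.141) p.247, (2.7) p.224, (2.12) p.225, (2.16) p.225; Balaban1984PropagatorsI, (1.109) p.35] -/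
theorem thm4_holder_member_V1_free (d ℓ : ℕ) (hd : 1 ≤ d + 1) (hL : Odd (ℓ + 1) ∧ 1 < ℓ + 1) {b₀ b₁ : ℝ} (hb₀ : 0 < b₀) (hb₁ : b₀ ≤ b₁) :
    ∃ σ₁ : ℝ, 0 < σ₁ ∧ ∀ (σ : ℝ), 0 < σ → σ ≤ σ₁ → ∀ (α : ℝ), 0 < α → α < 1 → ∀ (β : ℝ), 0 ≤ β → β < 1 →
    ∃ B₂ M₂ : ℝ, 0 ≤ B₂ ∧ 0 < M₂ ∧
    ∀ (m K : ℕ) {Mh k R : ℕ} {P' : Fin (d + 1) → ℕ}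
      (hN : ∀ μ, N0 ℓ Mh k P' μ = (PV d ℓ m K hd hL).sitesPerDir 0) (D : TDomains d ℓ Mh k P' R) (hk : k ≤ m + K) (_ : 1 ≤ k)
      {a : ℕ} (_ : Mh = (ℓ + 1) ^ a) (_ : 8 ≤ Mh) (_ : 2 * (ℓ + 1) ^ 2 ≤ R) (_ : ∀ μ, 5 * (ℓ + 1) ≤ P' μ) (_ : 4 ≤ ℓ)
      (_ : M₂ ≤ ((ℓ : ℝ) + 1) * Mh)
      {cf : ℝ} (hcf : cf ≠ 0) {w : BondIdx (domT hN D hk) → ℝ} (hw : ∀ i, 0 < w i) (_ : GlobalBand b₀ b₁ cf w),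
      ∀ (A' : BondSpace (PV d ℓ m K hd hL)) (α₀ α₁ : ℝ), 0 ≤ α₀ → 0 ≤ α₁ →
        -- (1.34) processed through (1.55) at `U₀ = 1`: `|D*DA′|₍₋₃₎ ≦ 2α₀`
        (∀ b, |dcsE cf (dcE cf A') b| ≤ 2 * α₀ * (((geomT D).len (blkV1 hN D b) * |cf|⁻¹) ^ 3)⁻¹) →
        -- (1.66)/(1.35) processed through (1.37)/(1.56): `|Q_jA′| ≦ 2dLα₁(Lʲη)⁻¹` on `Λ_j`
        (∀ i, |QE (domT hN D hk) A' i| ≤ 2 * ((d : ℝ) + 1) * ((ℓ : ℝ) + 1) * α₁ * (((ℓ : ℝ) + 1) ^ (i.1.1 : ℕ) * |cf|⁻¹)⁻¹) →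
      -- every restricted `λ` (1.29) in the Landau gauge (1.38)
      ∀ n : ScalarSpace (PV d ℓ m K hd hL), n ∈ LinearMap.ker (QpE (domT hN D hk)) →
        RE (domT hN D hk) cf (dsE cf (A' - dE cf n)) = 0 →
      -- every direction and every ADMISSIBLE pair of fine bonds (print: `x, x′ ∈ Δ̃(y)`, the Hölder norm on `Ω_j` at the scale `ξ = L^{−j}`)
      ∀ (ν : Fin (d + 1)) (x x' : PBond (PV d ℓ m K hd hL) 0), x.dir = x'.dir →
        supDist x.src x'.src ≤ (ℓ + 1) ^ (blkV1 hN D x).1.1 → supDist x.src x'.src ≤ (ℓ + 1) ^ (blkV1 hN D x').1.1 →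
        -- the Hölder member of (1.36)/(1.62) at the pair, `t^β`-form (before the division by `|x − x′|^β`, §5)
        |DV (P := PV d ℓ m K hd hL) ν cf (WithLp.ofLp (A' - dE cf n)) x -
            DV (P := PV d ℓ m K hd hL) ν cf (WithLp.ofLp (A' - dE cf n)) x'| ≤
          B₂ * (((supDist x.src x'.src : ℕ) : ℝ) / (((ℓ + 1 : ℕ) : ℝ)) ^ (blkV1 hN D x).1.1) ^ β * (α₀ + α₁) *
            (((geomT D).len (blkV1 hN D x) * |cf|⁻¹) ^ 2)⁻¹ := by
  obtain ⟨σ₁, hσ₁, h⟩ := ineq2137_pairMajorant_pad_V1 d ℓ hd hL hb₀ hb₁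
  refine ⟨σ₁, hσ₁, fun σ hσ hσ1 α hα0 hα1 β hβ0 hβ1 => ?_⟩
  -- §9 with the walk exponent `α` and the Hölder exponent `β` (p22's letters are the other way round)
  obtain ⟨A, M₂, hA, hM₂, h2⟩ := h σ hσ hσ1 α hα0 hα1.le β hβ0 hβ1
  -- §4's constants at the rate `δ₃ = delta3 α (2σ) = (1 − α)σ > 0`
  have hδ : 0 < delta3 α (2 * σ) := delta3_pos hα1 (by linarith)
  obtain ⟨B₀, N₁, hB₀, hN₁, h4⟩ := thm4_holder_member_V1 d ℓ hδ
  have hB₀0 : 0 ≤ B₀ := zero_le_one.trans hB₀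
  have hb₁1 : 0 ≤ 1 + 2 * b₁ := by linarith
  refine ⟨2 * ((d : ℝ) + 1) * ((ℓ : ℝ) + 1) * B₀ * A * (1 + 2 * b₁), max M₂ ((N₁ : ℝ) + 1),
    mul_nonneg (mul_nonneg (mul_nonneg (by positivity) hB₀0) hA) hb₁1, lt_max_of_lt_left hM₂, ?_⟩
  intro m K Mh k R P' hN D hk hk1 a hMha hM8 hR2 hP hℓ hM cf hcf w hw hwb A' α₀ α₁ hα₀ hα₁ hJ hB n hn hLan ν x x' hdir hs1 hs2
  -- the single threshold implies the two it replaces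
  have hM2t : M₂ ≤ ((ℓ : ℝ) + 1) * Mh := le_trans (le_max_left _ _) hM
  have hN1r : (N₁ : ℝ) + 1 ≤ ((ℓ : ℝ) + 1) * Mh := le_trans (le_max_right _ _) hM
  have hN1t : N₁ + 1 ≤ R * ((ℓ + 1) * Mh) := by
    have h1 : N₁ + 1 ≤ (ℓ + 1) * Mh := by exact_mod_cast hN1r
    have hR1 : 1 ≤ R := le_trans (Nat.one_le_iff_ne_zero.mpr (by positivity)) hR2
    calc N₁ + 1 ≤ (ℓ + 1) * Mh := h1
      _ = 1 * ((ℓ + 1) * Mh) := (one_mul _).symm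
      _ ≤ R * ((ℓ + 1) * Mh) := Nat.mul_le_mul_right _ hR1
  have hMh1 : 1 ≤ Mh := le_trans (by norm_num) hM8
  have hP1 : ∀ μ, 1 ≤ P' μ := fun μ => le_trans (by omega) (hP μ)
  have hb₁0 : 0 ≤ b₁ := hb₀.le.trans hb₁
  -- the pair majorant for the admissible pair, written with the constant `C_P := A·t^β`
  set tβ : ℝ := ((((supDist x.src x'.src : ℕ) : ℝ) / (((ℓ + 1 : ℕ) : ℝ)) ^ (blkV1 hN D x).1.1) ^ β) with htβ
  have htβ0 : 0 ≤ tβ := Real.rpow_nonneg (by positivity) _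
  have hpair := h2 m K hN D hk hk1 hMha hM8 hR2 hP hℓ hM2t hcf hw hwb ν x x' hdir hs1 hs2
  have hpair' : HasMajorant (g := geomT D) (blkV1 hN D)
      (pairOp x x' * DV (P := PV d ℓ m K hd hL) ν cf * onFun (GE (domT hN D hk) hcf hw))
      (fun y y' => A * tβ * ((geomT D).len y * |cf|⁻¹) * Real.exp (-(delta3 α (2 * σ) * (geomT D).dist y y'))) :=
    hasMajorant_mono (g := geomT D) (blkV1 hN D) hpair fun y y' => le_of_eq (by rw [htβ]; ring)
  have key := h4 k Mh R hMh1 hN1t P' hP1 D m K hd hL hN hk cf hcf w hw b₀ b₁ hb₀.le hb₁0 hwb A' α₀ α₁ hα₀ hα₁ hJ hB n hn hLan ν x x'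
    (A * tβ) (mul_nonneg hA htβ0) hpair'
  refine key.trans (le_of_eq ?_)
  ring

end Thm4Free


/-! ## §11  (v1.2) THEOREM 2 AT `U₀ = 1` ON THE `k`-LEVEL V1 TORUS WITH THE COMPLETE CONCLUSION LIST (1.36)–(1.39) — HYPOTHESIS-FREE
(§7 `thm2_multiLevelTorus_V1_five` with its (2.137)₁ pair majorant discharged by §10) -/

section Thm2FiveFree

open LatticeFieldCalculus (supDist laplace)
open B8Thm4MultiLevelTorus (thm4_multiLevelTorus_V1)
open B8ScaledSupNorm (msup)

open Classical in
/-- **THEOREM 2 AT `U₀ = 1` ON THE `k`-LEVEL V1 TORUS, THE COMPLETE LIST (1.36)–(1.39), NO [B6]-SIDE HYPOTHESIS** (p. 83, verbatim: *"**Theorem 2.**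
There exist constants B₁, B₂(β₀), c₁ such that for arbitrary U₀, U′U₀ satisfying (1.33)–(1.35) with α₀ + α₁ ≦ c₁ there exists exactly one
gauge transformation u satisfying (1.29) and such that the conditions (1.36)–(1.39) hold for the configuration U₁ = U′^{u⁻¹}"*; *"Of course we
want to prove that the constants B₁, B₂(β₀) in (1.36), (1.39) are absolute constants depending on d and L only, B₂(β₀) on β₀ also"*) — typed
reading in the linear chart at `U₀ = 1` (THE INSTANCE; (1.33) void at `U₀ = 1`, (1.34)/(1.35) in their processed forms (1.55)/(1.37); THE
THRESHOLD «α₀ + α₁ ≦ c₁» IS NOT NEEDED in the linear chart and is NOT assumed — the statement below is stronger for omitting it; the same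
holds for §7): own `thm4_multiLevelTorus_V1` (p383020: ∃! restricted Landau `λ`, (1.37), the four sup members with `B₁ = 5dL·B₀′`) AND §10
`thm4_holder_member_V1_free` (the Hölder member, hypothesis-free) in ONE sentence.  For the weight band `0 < b₀ ≤ b₁` there is `σ₀ > 0` such
that for all `σ ∈ (0, σ₀]`, `α ∈ (0, 1)` ([B6] walk exponent) and `β ∈ [0, 1)` (Hölder exponent, «β ≦ β₀ < 1») there are constants `B₁ ≥ 1`,
`B₂ ≥ 0` («B₂(β₀) on β₀ also») and ONE size threshold `M₄ > 0` with: on every admissible `k`-level V1 torus (every odd `L ≥ 5`, `k ≥ 1`,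
`M_h = Lᵃ ≥ 8`, `R ≥ 2L²`, `P′ ≥ 5L`, `M₄ ≤ L·M_h`, `c′ ≠ 0`, weights in the band), for every `α₀, α₁ ≥ 0` and every `A′` with the processed
(1.34)/(1.66) sizes: ∃! `λ ∈ N(Q′)` [(1.29)] with `R∂*(A′ − ∂λ) = 0` [(1.38)], and for every such `λ`, `A := A′ − ∂λ` satisfies (1.37)
`QA = QA′`, (1.36) `|A|₍₋₁₎, |∇A|₍₋₂₎ ≦ B₁(α₀ + α₁)`, (1.39) `|(D*DA)(b)| ≦ B₁(α₀ + α₁)(L^{j(b)}η)⁻³`, `|ΔA|₍₋₃₎ ≦ B₁(α₀ + α₁)`, AND the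
third member of (1.36): for every direction `ν` and every admissible pair `(x, x′)` (same direction, `|x − x′|_∞ ≤ L^{j(y(x))}`,
`|x − x′|_∞ ≤ L^{j(y(x′))}`; `t := |x − x′|_∞/L^{j(y(x))}`) **`|(∇_νA)(x) − (∇_νA)(x′)| ≦ B₂·t^β·(α₀ + α₁)·((L^{j(y(x))})η)⁻²`** — by §5
print's `‖A‖_{1,β} ≦ B₂(α₀ + α₁)(Lʲη)^{−2−β}` pair by pair.  «≦» for print's «<»; `d, L` of print = `d + 1`, `ℓ + 1`.
[cite: Balaban1985RegularSpaces, Thm 2 p.83, (1.36)–(1.38) p.82, (1.39) p.83, (1.62) + Prop. 3 p.87, Thm 4 p.88, (1.29) p.81, (1.33)–(1.35) p.82; Balaban1984PropagatorsII, Prop. 2.6 (2.136)–(2.137) p.247, (2.7) p.224, (2.12) p.225; Balaban1984PropagatorsI, (1.109) p.35] -/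
theorem thm2_multiLevelTorus_V1_five_free (d ℓ : ℕ) (hd : 1 ≤ d + 1) (hL : Odd (ℓ + 1) ∧ 1 < ℓ + 1) {b₀ b₁ : ℝ} (hb₀ : 0 < b₀)
    (hb₁ : b₀ ≤ b₁) :
    ∃ σ₀ : ℝ, 0 < σ₀ ∧ ∀ (σ : ℝ), 0 < σ → σ ≤ σ₀ → ∀ (α : ℝ), 0 < α → α < 1 → ∀ (β : ℝ), 0 ≤ β → β < 1 →
    ∃ B₁ B₂ M₄ : ℝ, 1 ≤ B₁ ∧ 0 ≤ B₂ ∧ 0 < M₄ ∧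
    ∀ (m K : ℕ) {Mh k R : ℕ} {P' : Fin (d + 1) → ℕ}
      (hN : ∀ μ, N0 ℓ Mh k P' μ = (PV d ℓ m K hd hL).sitesPerDir 0) (D : TDomains d ℓ Mh k P' R) (hk : k ≤ m + K) (_ : 1 ≤ k)
      {a : ℕ} (_ : Mh = (ℓ + 1) ^ a) (_ : 8 ≤ Mh) (_ : 2 * (ℓ + 1) ^ 2 ≤ R) (_ : ∀ μ, 5 * (ℓ + 1) ≤ P' μ) (_ : 4 ≤ ℓ)
      (_ : M₄ ≤ ((ℓ : ℝ) + 1) * Mh)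
      {cf : ℝ} (hcf : cf ≠ 0) {w : BondIdx (domT hN D hk) → ℝ} (hw : ∀ i, 0 < w i) (_ : GlobalBand b₀ b₁ cf w),
      ∀ (A' : BondSpace (PV d ℓ m K hd hL)) (α₀ α₁ : ℝ), 0 ≤ α₀ → 0 ≤ α₁ →
        (∀ b, |dcsE cf (dcE cf A') b| ≤ 2 * α₀ * (((geomT D).len (blkV1 hN D b) * |cf|⁻¹) ^ 3)⁻¹) →
        (∀ i, |QE (domT hN D hk) A' i| ≤ 2 * ((d : ℝ) + 1) * ((ℓ : ℝ) + 1) * α₁ * (((ℓ : ℝ) + 1) ^ (i.1.1 : ℕ) * |cf|⁻¹)⁻¹) →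
        -- «exactly one gauge transformation u satisfying (1.29) and … (1.38)»
        (∃! n : ScalarSpace (PV d ℓ m K hd hL),
            n ∈ LinearMap.ker (QpE (domT hN D hk)) ∧ RE (domT hN D hk) cf (dsE cf (A' - dE cf n)) = 0) ∧
        ∀ n : ScalarSpace (PV d ℓ m K hd hL), n ∈ LinearMap.ker (QpE (domT hN D hk)) →
          RE (domT hN D hk) cf (dsE cf (A' - dE cf n)) = 0 →
          -- (1.37)
          QE (domT hN D hk) (A' - dE cf n) = QE (domT hN D hk) A' ∧
          -- (1.36) sup members
          msup (ℓ + 1) k |cf|⁻¹ (-1) (fun j (b : PBond (PV d ℓ m K hd hL) 0) => j ≤ (blkV1 hN D b).1.1) (WithLp.ofLp (A' - dE cf n)) ≤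
              B₁ * (α₀ + α₁) ∧
          msup (ℓ + 1) k |cf|⁻¹ (-2) (fun j (p : Fin (d + 1) × PBond (PV d ℓ m K hd hL) 0) => j ≤ (blkV1 hN D p.2).1.1)
              (fun p : Fin (d + 1) × PBond (PV d ℓ m K hd hL) 0 => DV (P := PV d ℓ m K hd hL) p.1 cf (WithLp.ofLp (A' - dE cf n)) p.2) ≤
              B₁ * (α₀ + α₁) ∧
          -- (1.39)
          (∀ b : PBond (PV d ℓ m K hd hL) 0,
              |dcsE cf (dcE cf (A' - dE cf n)) b| ≤ B₁ * (α₀ + α₁) * (((geomT D).len (blkV1 hN D b) * |cf|⁻¹) ^ 3)⁻¹) ∧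
          msup (ℓ + 1) k |cf|⁻¹ (-3) (fun j (b : PBond (PV d ℓ m K hd hL) 0) => j ≤ (blkV1 hN D b).1.1)
              (fun b : PBond (PV d ℓ m K hd hL) 0 => laplace cf (fun z => (A' - dE cf n) ⟨z, b.dir⟩) b.src) ≤ B₁ * (α₀ + α₁) ∧
          -- (1.36) the Hölder member, for every admissible pair, NO [B6]-side hypothesis
          (∀ (ν : Fin (d + 1)) (x x' : PBond (PV d ℓ m K hd hL) 0), x.dir = x'.dir →
            supDist x.src x'.src ≤ (ℓ + 1) ^ (blkV1 hN D x).1.1 → supDist x.src x'.src ≤ (ℓ + 1) ^ (blkV1 hN D x').1.1 →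
            |DV (P := PV d ℓ m K hd hL) ν cf (WithLp.ofLp (A' - dE cf n)) x -
                DV (P := PV d ℓ m K hd hL) ν cf (WithLp.ofLp (A' - dE cf n)) x'| ≤
              B₂ * (((supDist x.src x'.src : ℕ) : ℝ) / (((ℓ + 1 : ℕ) : ℝ)) ^ (blkV1 hN D x).1.1) ^ β * (α₀ + α₁) *
                (((geomT D).len (blkV1 hN D x) * |cf|⁻¹) ^ 2)⁻¹) := by
  obtain ⟨σ₀, hσ₀, h4⟩ := thm4_multiLevelTorus_V1 d ℓ hd hL hb₀ hb₁
  obtain ⟨σ₁, hσ₁, hH⟩ := thm4_holder_member_V1_free d ℓ hd hL hb₀ hb₁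
  refine ⟨min σ₀ σ₁, lt_min hσ₀ hσ₁, fun σ hσ hσle α hα0 hα1 β hβ0 hβ1 => ?_⟩
  obtain ⟨B₀', M₄, hB₀', hM₄, h⟩ := h4 σ hσ (hσle.trans (min_le_left _ _)) α hα0 hα1
  obtain ⟨B₂, M₂, hB₂, hM₂, hH2⟩ := hH σ hσ (hσle.trans (min_le_right _ _)) α hα0 hα1 β hβ0 hβ1
  have hdL : (1 : ℝ) ≤ ((d : ℝ) + 1) * ((ℓ : ℝ) + 1) :=
    one_le_mul_of_one_le_of_one_le (le_add_of_nonneg_left (Nat.cast_nonneg d)) (le_add_of_nonneg_left (Nat.cast_nonneg ℓ))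
  refine ⟨5 * ((d : ℝ) + 1) * ((ℓ : ℝ) + 1) * B₀', B₂, max M₄ M₂, ?_, hB₂, lt_max_of_lt_left hM₄, ?_⟩
  · calc (1 : ℝ) ≤ 5 * (((d : ℝ) + 1) * ((ℓ : ℝ) + 1)) * 1 := by linarith
      _ ≤ 5 * (((d : ℝ) + 1) * ((ℓ : ℝ) + 1)) * B₀' := mul_le_mul_of_nonneg_left hB₀' (by positivity)
      _ = 5 * ((d : ℝ) + 1) * ((ℓ : ℝ) + 1) * B₀' := by ring
  intro m K Mh k R P' hN D hk hk1 a hMha hM8 hR2 hP hℓ4 hMt cf hcf w hw hwb A' α₀ α₁ hα₀ hα₁ hJ hB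
  have hM4t : M₄ ≤ ((ℓ : ℝ) + 1) * Mh := le_trans (le_max_left _ _) hMt
  have hM2t : M₂ ≤ ((ℓ : ℝ) + 1) * Mh := le_trans (le_max_right _ _) hMt
  obtain ⟨hex, hall⟩ := h m K hN D hk hk1 hMha hM8 hR2 hP hℓ4 hM4t hcf hw hwb A' α₀ α₁ hα₀ hα₁ hJ hB
  refine ⟨hex, fun n hn hLan => ?_⟩
  obtain ⟨h37, _, hA1, hA2, hJ3, hA4, _, _, _⟩ := hall n hn hLan
  refine ⟨h37, hA1, hA2, hJ3, hA4, fun ν x x' hdir hs1 hs2 => ?_⟩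
  exact hH2 m K hN D hk hk1 hMha hM8 hR2 hP hℓ4 hM2t hcf hw hwb A' α₀ α₁ hα₀ hα₁ hJ hB n hn hLan ν x x' hdir hs1 hs2

end Thm2FiveFree


/-! ## §12  (v1.2) Proposition 3's Hölder member IN PROPOSITION 3's OWN SETTING — NO [B6]-SIDE HYPOTHESIS (§8 with the pair majorant discharged by §9) -/

section Prop3HolderFree

open LatticeFieldCalculus (supDist)
open B6RandomWalk (delta3 delta3_pos)
open B8Prop3MultiLevelTorusP26 (prop3_multiLevelTorus_V1_P26_vector)
open B8ScaledSupNorm (msup)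

open Classical in
/-- **PROPOSITION 3's HÖLDER MEMBER «‖A‖_{1,β} < 5dLB₀(β)(α₀ + α₁)(Lʲη)^{−2−β}» AT `U₀ = 1` ON THE `k`-LEVEL V1 TORUS IN PROPOSITION 3's OWN
SETTING — HYPOTHESIS-FREE ON THE [B6] SIDE** (p. 87: *"**Proposition 3.** If U₀, U₁U₀ satisfy (1.40)–(1.42) with α₀, α₁, α₂ bounded by a
constant depending on d and L only, and α₂ satisfies the additional restriction (1.61), then U₁ satisfies (1.36)–(1.39) with B₁ = 5dLB₀,
B₂(β₀) = 5dLB₀(β₀), where B₀, B₀(β₀) are the corresponding norms of the operators G(U₀), H(U₀), and depend on d and L only, B₀(β₀) on β₀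
also"*): §8 `prop3_holder_member_V1_P26` with the (2.137)₁ pair majorant of its last hypothesis DISCHARGED by §9 (p22's H3b on the padded
family) at the rate `δ₃ = delta3 α (2σ)`.  For the band `0 < b₀ ≤ b₁` there is `σ₀ > 0` and for all `σ ∈ (0, σ₀]`, `α ∈ (0, 1)` ([B6] walk
exponent), `β ∈ [0, 1)` (Hölder exponent) constants `B₀, K_L ≥ 1`, `A ≥ 0` (as in own `prop3_multiLevelTorus_V1_P26_vector`; `B₀′ =
K_L(B₀A + 1)(1 + 2b₁)`), **`B₀(β) ≥ 0`** (print's «B₀(β₀)», here `B_H·A_H·(1 + 2b₁)`) and ONE size threshold `M₄ > 0` such that on every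
admissible `k`-level V1 torus (every odd `L ≥ 5`, `k ≥ 1`, `M_h = Lᵃ ≥ 8`, `R ≥ 2L²`, `P′ ≥ 5L`, `M₄ ≤ L·M_h`, `c′ ≠ 0`, weights in the band),
for every `A` with (1.55) `∂*∂A = J`, (1.42) `R∂*A = 0`, (1.56) `QA = B`, sizes `|J(b)| ≦ n_J((L^{j(b)})η)⁻³`, `|B_{(j,c)}| ≦ n_B((Lʲ)η)⁻¹`,
reals `d_P ≥ 0`, `L_P` (`d_PL_P ≥ 1`), `C₂`, `α₀, α₁, α₂ ≥ 0` subject to the (1.55) size line «n_J ≦ 2α₀ + 36dα₂|∇A|₍₋₂₎ + 50dα₂³ + 10dα₀α₂»,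
the (1.56) line «n_B ≦ 2dLα₁ + C₂α₂²», «B₀′36dα₂ ≦ ½», `50dα₂ ≤ 1` and (1.61), and for every direction `ν` and admissible pair `(x, x′)` (same
direction, `|x − x′|_∞ ≤ L^{j(y(x))}`, `|x − x′|_∞ ≤ L^{j(y(x′))}`; `t := |x − x′|_∞/L^{j(y(x))}`):
**`|(∇_νA)(x) − (∇_νA)(x′)| ≦ 5d_PL_P·B₀(β)·t^β·(α₀ + α₁)·((L^{j(y(x))})η)⁻²`** — print's `B₂(β₀) = 5dLB₀(β₀)` on the nose, and by §5 the
printed `(Lʲη)^{−2−β}` form.  «≦» for «<».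
[cite: Balaban1985RegularSpaces, Prop. 3 p.87, (1.62) p.87, (1.59)–(1.61) p.86, (1.55)–(1.56) p.86, (1.36) p.82, (1.40)–(1.42) p.83; Balaban1984PropagatorsII, Prop. 2.6 (2.136)–(2.137) p.247, (2.141) p.247, (2.16) p.225; Balaban1984PropagatorsI, (1.109) p.35; Balaban1985BackgroundPropagators, Theorem 3.3 p.399] -/
theorem prop3_holder_member_V1_P26_free (d ℓ : ℕ) (hd : 1 ≤ d + 1) (hL : Odd (ℓ + 1) ∧ 1 < ℓ + 1) {b₀ b₁ : ℝ} (hb₀ : 0 < b₀)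
    (hb₁ : b₀ ≤ b₁) :
    ∃ σ₀ : ℝ, 0 < σ₀ ∧ ∀ (σ : ℝ), 0 < σ → σ ≤ σ₀ → ∀ (α : ℝ), 0 < α → α < 1 → ∀ (β : ℝ), 0 ≤ β → β < 1 →
    ∃ B₀ KL : ℝ, 1 ≤ B₀ ∧ 1 ≤ KL ∧
    ∃ Amaj BHo M₄ : ℝ, 0 ≤ Amaj ∧ 0 ≤ BHo ∧ 0 < M₄ ∧
    ∀ (m K : ℕ) {Mh k R : ℕ} {P' : Fin (d + 1) → ℕ}
      (hN : ∀ μ, N0 ℓ Mh k P' μ = (PV d ℓ m K hd hL).sitesPerDir 0) (D : TDomains d ℓ Mh k P' R) (hk : k ≤ m + K) (_ : 1 ≤ k)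
      {a : ℕ} (_ : Mh = (ℓ + 1) ^ a) (_ : 8 ≤ Mh) (_ : 2 * (ℓ + 1) ^ 2 ≤ R) (_ : ∀ μ, 5 * (ℓ + 1) ≤ P' μ) (_ : 4 ≤ ℓ)
      (_ : M₄ ≤ ((ℓ : ℝ) + 1) * Mh)
      {cf : ℝ} (hcf : cf ≠ 0) {w : BondIdx (domT hN D hk) → ℝ} (hw : ∀ i, 0 < w i) (_ : GlobalBand b₀ b₁ cf w),
      ∀ (A J : BondSpace (PV d ℓ m K hd hL)) (B : BondIdxSpace (domT hN D hk)),
        dcsE cf (dcE cf A) = J → RE (domT hN D hk) cf (dsE cf A) = 0 → QE (domT hN D hk) A = B →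
        ∀ (nJ nB : ℝ), 0 ≤ nJ → 0 ≤ nB →
          (∀ b, |J b| ≤ nJ * (((geomT D).len (blkV1 hN D b) * |cf|⁻¹) ^ 3)⁻¹) →
          (∀ i, |B i| ≤ nB * (((ℓ : ℝ) + 1) ^ (i.1.1 : ℕ) * |cf|⁻¹)⁻¹) →
        ∀ (dP LP C₂ α₀ α₁ α₂ : ℝ), 0 ≤ dP → 1 ≤ dP * LP → 0 ≤ α₀ → 0 ≤ α₁ → 0 ≤ α₂ →
          -- (1.55) size line with the `|∇A|₍₋₂₎`-term
          nJ ≤ 2 * α₀ + 36 * dP * α₂ *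
              msup (ℓ + 1) k |cf|⁻¹ (-2) (fun j (p : Fin (d + 1) × PBond (PV d ℓ m K hd hL) 0) => j ≤ (blkV1 hN D p.2).1.1)
                (fun p : Fin (d + 1) × PBond (PV d ℓ m K hd hL) 0 => DV (P := PV d ℓ m K hd hL) p.1 cf (WithLp.ofLp A) p.2) +
            50 * dP * α₂ ^ 3 + 10 * dP * α₀ * α₂ →
          -- (1.56) size line
          nB ≤ 2 * dP * LP * α₁ + C₂ * α₂ ^ 2 →
          -- «B₀36dα₂ ≦ 1/2» (for `B₀′`), `50dα₂ ≤ 1`, (1.61)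
          36 * dP * (KL * ((B₀ * Amaj + 1) * (1 + 2 * b₁))) * α₂ ≤ 1 / 2 → 50 * dP * α₂ ≤ 1 →
          2 * α₂ ^ 2 + 20 * dP * α₀ * α₂ + 2 * C₂ * α₂ ^ 2 ≤ α₀ + α₁ →
        -- every direction and every ADMISSIBLE pair of fine bonds
        ∀ (ν : Fin (d + 1)) (x x' : PBond (PV d ℓ m K hd hL) 0), x.dir = x'.dir →
          supDist x.src x'.src ≤ (ℓ + 1) ^ (blkV1 hN D x).1.1 → supDist x.src x'.src ≤ (ℓ + 1) ^ (blkV1 hN D x').1.1 →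
          |DV (P := PV d ℓ m K hd hL) ν cf (WithLp.ofLp A) x - DV (P := PV d ℓ m K hd hL) ν cf (WithLp.ofLp A) x'| ≤
            5 * dP * LP * BHo * (((supDist x.src x'.src : ℕ) : ℝ) / (((ℓ + 1 : ℕ) : ℝ)) ^ (blkV1 hN D x).1.1) ^ β * (α₀ + α₁) *
              (((geomT D).len (blkV1 hN D x) * |cf|⁻¹) ^ 2)⁻¹ := by
  obtain ⟨σ₀, hσ₀, hV⟩ := prop3_multiLevelTorus_V1_P26_vector d ℓ hd hL hb₀ hb₁
  obtain ⟨σ₁, hσ₁, hM9⟩ := ineq2137_pairMajorant_pad_V1 d ℓ hd hL hb₀ hb₁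
  refine ⟨min σ₀ σ₁, lt_min hσ₀ hσ₁, fun σ hσ hσle α hα0 hα1 β hβ0 hβ1 => ?_⟩
  obtain ⟨B₀, KL, hB₀, hKL, Amaj, M₄, hA, hM₄, hP3⟩ := hV σ hσ (hσle.trans (min_le_left _ _)) α hα0 hα1
  -- §9's constants (walk exponent `α`, Hölder exponent `β`) and §3's at the rate `δ₃ = delta3 α (2σ)`
  obtain ⟨AH, M₂, hAH, hM₂, h2⟩ := hM9 σ hσ (hσle.trans (min_le_right _ _)) α hα0 hα1.le β hβ0 hβ1
  have hδ : 0 < delta3 α (2 * σ) := delta3_pos hα1 (by linarith)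
  obtain ⟨BH, N₁, hBH, hN₁, hH⟩ := ineq159_holder_member_pref d ℓ hδ
  have hBH0 : 0 ≤ BH := zero_le_one.trans hBH
  have hb₁1 : 0 ≤ 1 + 2 * b₁ := by linarith
  refine ⟨B₀, KL, hB₀, hKL, Amaj, BH * AH * (1 + 2 * b₁), max M₄ (max M₂ ((N₁ : ℝ) + 1)), hA,
    mul_nonneg (mul_nonneg hBH0 hAH) hb₁1, lt_max_of_lt_left hM₄, ?_⟩
  intro m K Mh k R P' hN D hk hk1 a hMha hM8 hR2 hP hℓ4 hMt cf hcf w hw hwb A J B h55 h42 h56 nJ nB hnJ hnB hJ hB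
    dP LP C₂ α₀ α₁ α₂ hdP hdL hα₀ hα₁ hα₂ h55s h56s hside h50 h61 ν x x' hdir hs1 hs2
  -- the single threshold implies the three it replaces
  have hM4t : M₄ ≤ ((ℓ : ℝ) + 1) * Mh := le_trans (le_max_left _ _) hMt
  have hM2t : M₂ ≤ ((ℓ : ℝ) + 1) * Mh := le_trans ((le_max_left _ _).trans (le_max_right _ _)) hMt
  have hN1r : (N₁ : ℝ) + 1 ≤ ((ℓ : ℝ) + 1) * Mh := le_trans ((le_max_right _ _).trans (le_max_right _ _)) hMt
  have hN1t : N₁ + 1 ≤ R * ((ℓ + 1) * Mh) := by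
    have h1 : N₁ + 1 ≤ (ℓ + 1) * Mh := by exact_mod_cast hN1r
    have hR1 : 1 ≤ R := le_trans (Nat.one_le_iff_ne_zero.mpr (by positivity)) hR2
    calc N₁ + 1 ≤ (ℓ + 1) * Mh := h1
      _ = 1 * ((ℓ + 1) * Mh) := (one_mul _).symm
      _ ≤ R * ((ℓ + 1) * Mh) := Nat.mul_le_mul_right _ hR1
  -- the bootstrap of `g = |∇A|₍₋₂₎` from the hypothesis-free Proposition 3 (v1.5 `_vector`)
  obtain ⟨-, hg, -, -, -, -, -⟩ := hP3 m K hN D hk hk1 hMha hM8 hR2 hP hℓ4 hM4t hcf hw hwb A J B h55 h42 h56 nJ nB hnJ hnB hJ hB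
    dP LP C₂ α₀ α₁ α₂ hdP hdL hα₀ hα₁ hα₂ h55s h56s hside h50 h61
  set B₀' : ℝ := KL * ((B₀ * Amaj + 1) * (1 + 2 * b₁))
  set g : ℝ := msup (ℓ + 1) k |cf|⁻¹ (-2) (fun j (p : Fin (d + 1) × PBond (PV d ℓ m K hd hL) 0) => j ≤ (blkV1 hN D p.2).1.1)
      (fun p : Fin (d + 1) × PBond (PV d ℓ m K hd hL) 0 => DV (P := PV d ℓ m K hd hL) p.1 cf (WithLp.ofLp A) p.2)
  -- the (2.137)₁ pair majorant for the admissible pair (§9), constant `C_P := A_H·t^β`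
  set tβ : ℝ := ((((supDist x.src x'.src : ℕ) : ℝ) / (((ℓ + 1 : ℕ) : ℝ)) ^ (blkV1 hN D x).1.1) ^ β) with htβ
  have htβ0 : 0 ≤ tβ := Real.rpow_nonneg (by positivity) _
  have hpair := h2 m K hN D hk hk1 hMha hM8 hR2 hP hℓ4 hM2t hcf hw hwb ν x x' hdir hs1 hs2
  have hPair : HasMajorant (g := geomT D) (blkV1 hN D)
      (pairOp x x' * DV (P := PV d ℓ m K hd hL) ν cf * onFun (GE (domT hN D hk) hcf hw))
      (fun y y' => AH * tβ * ((geomT D).len y * |cf|⁻¹) * Real.exp (-(delta3 α (2 * σ) * (geomT D).dist y y'))) :=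
    hasMajorant_mono (g := geomT D) (blkV1 hN D) hpair fun y y' => le_of_eq (by rw [htβ]; ring)
  -- the Hölder numerator from §3 (the window is the band, `η = |c′|⁻¹`)
  have hMh1 : 1 ≤ Mh := le_trans (by norm_num) hM8
  have hP1 : ∀ μ, 1 ≤ P' μ := fun μ => le_trans (by omega) (hP μ)
  have hb₁0 : 0 ≤ b₁ := hb₀.le.trans hb₁
  have hnum := hH k Mh R hMh1 hN1t P' hP1 D m K hd hL hN hk cf hcf w hw b₀ b₁ hb₀.le hb₁0 hwb ν x x' (AH * tβ) (mul_nonneg hAH htβ0)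
    hPair A J B h55 h42 h56 nJ nB hnJ hnB hJ hB
  -- the printed arithmetic (1.59) ⟹ (1.60) ⟹ (1.62): `|J|₍₋₃₎ + |B₁| ≦ 5d_PL_P(α₀ + α₁)` (verbatim as in §8)
  have hS : 0 ≤ α₀ + α₁ := add_nonneg hα₀ hα₁
  have hdLP : 0 ≤ dP * LP := by linarith
  have h36 : 36 * dP * α₂ * g ≤ 5 / 2 * (dP * LP) * (α₀ + α₁) := by
    have h1 : 36 * dP * α₂ * g ≤ 36 * dP * α₂ * (5 * dP * LP * B₀' * (α₀ + α₁)) :=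
      mul_le_mul_of_nonneg_left hg (by positivity)
    have h2 : 36 * dP * α₂ * (5 * dP * LP * B₀' * (α₀ + α₁)) = (36 * dP * B₀' * α₂) * (5 * (dP * LP) * (α₀ + α₁)) := by ring
    have h3 : (36 * dP * B₀' * α₂) * (5 * (dP * LP) * (α₀ + α₁)) ≤ (1 / 2) * (5 * (dP * LP) * (α₀ + α₁)) :=
      mul_le_mul_of_nonneg_right hside (mul_nonneg (mul_nonneg (by norm_num) hdLP) hS)
    linarith
  have h50' : 50 * dP * α₂ ^ 3 ≤ α₂ ^ 2 := by
    have : 50 * dP * α₂ ^ 3 = (50 * dP * α₂) * α₂ ^ 2 := by ring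
    rw [this]
    exact (mul_le_mul_of_nonneg_right h50 (sq_nonneg α₂)).trans (by rw [one_mul])
  have hsum : nJ + nB ≤ 5 * dP * LP * (α₀ + α₁) := by
    nlinarith [mul_nonneg (sub_nonneg.2 hdL) hα₀, mul_nonneg (sub_nonneg.2 hdL) hα₁]
  -- assemble
  have hw2 : (0 : ℝ) ≤ (((geomT D).len (blkV1 hN D x) * |cf|⁻¹) ^ 2)⁻¹ :=
    inv_nonneg.2 (pow_nonneg (mul_nonneg (lenT_pos D _).le (inv_nonneg.2 (abs_nonneg cf))) 2)
  have hfac : 0 ≤ BH * (AH * tβ) * (1 + 2 * b₁) := mul_nonneg (mul_nonneg hBH0 (mul_nonneg hAH htβ0)) hb₁1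
  refine hnum.trans ?_
  calc BH * (AH * tβ) * (1 + 2 * b₁) * (nJ + nB) * (((geomT D).len (blkV1 hN D x) * |cf|⁻¹) ^ 2)⁻¹
      ≤ BH * (AH * tβ) * (1 + 2 * b₁) * (5 * dP * LP * (α₀ + α₁)) * (((geomT D).len (blkV1 hN D x) * |cf|⁻¹) ^ 2)⁻¹ :=
        mul_le_mul_of_nonneg_right (mul_le_mul_of_nonneg_left hsum hfac) hw2
    _ = 5 * dP * LP * (BH * AH * (1 + 2 * b₁)) * tβ * (α₀ + α₁) * (((geomT D).len (blkV1 hN D x) * |cf|⁻¹) ^ 2)⁻¹ := by ring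

end Prop3HolderFree

/-! ## §13  (v1.2) The same written as print writes it: the HÖLDER QUOTIENT of [B5] (1.109) over ADMISSIBLE pairs, in r03/p27's census
vocabulary `B6HolderNormV1.AdmV1` / `tparV1` (no new definition) -/

section Quotient1109

open B6HolderNormV1 (AdmV1 tparV1 tparV1_nonneg)

open Classical in
/-- **THE THIRD MEMBER OF (1.36)/(1.62) AS A HÖLDER QUOTIENT, HYPOTHESIS-FREE** ([B5] (1.109): *"‖A‖_α = max_μ sup_{x,x′: |x−x′| ≤ 1}
|x − x′|^{−α}|A_μ(x) − A_μ(x′)|"* (pairs at the scale `ξ`); (1.36): *"‖A‖_{1,β} < B₂(β₀)(α₀ + α₁)(Lʲη)^{−2−β}, β ≦ β₀ < 1, on Ω_j"*): §10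
`thm4_holder_member_V1_free` rewritten in r03/p27's census vocabulary — `AdmV1 hN D x x′` (the admissible ordered pairs: same direction,
`|x − x′|_∞ ≤ L^{j(y(x))}`, `|x − x′|_∞ ≤ L^{j(y(x′))}`; print's «x, x′ ∈ Δ̃(y)») and `tparV1 hN D x x′ = t = |x − x′|_∞/L^{j(y(x))}` of
`B6HolderNormV1` (p27; the raw-data copies of r03's `B6KLevelCensusIndexV1.Adm`/`tpar`): under the binders of §10 (every odd `L ≥ 5`, `k ≥ 1`,
`P′ ≥ 5L`, ONE threshold, the band; Theorem 4's processed sizes; any restricted Landau `λ`), for every direction `ν` and every admissible pair,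
**`t^{−β}·|(∇_νA)(x) − (∇_νA)(x′)| ≦ B₂·(α₀ + α₁)·((L^{j(y(x))})η)⁻²`** for `A := A′ − ∂λ` — since the physical distance is `|x − x′| = t·L^{j}η`,
this IS print's `|x − x′|^{−β}|(∇A)(x) − (∇A)(x′)| ≦ B₂(α₀ + α₁)(Lʲη)^{−2−β}` at the pair, for the strongest admissible `j = j(y(x))` (hence on
every `Ω_j ∋ x`, the weight being monotone in `j`); at `t = 0` (`x = x′`) both sides are trivial.  No Hölder-norm VALUE is asserted beyond the
pairwise quotient (p27's `holderV1` is the sup of exactly these terms at one scale).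
[cite: Balaban1985RegularSpaces, (1.36) p.82, (1.62) + Prop. 3 p.87, Thm 2 p.83, Thm 4 p.88; Balaban1984PropagatorsI, (1.109) p.35; Balaban1984PropagatorsII, Prop. 2.6 (2.137)–(2.138) p.247] -/
theorem thm4_holder_quotient_V1_free (d ℓ : ℕ) (hd : 1 ≤ d + 1) (hL : Odd (ℓ + 1) ∧ 1 < ℓ + 1) {b₀ b₁ : ℝ} (hb₀ : 0 < b₀) (hb₁ : b₀ ≤ b₁) :
    ∃ σ₁ : ℝ, 0 < σ₁ ∧ ∀ (σ : ℝ), 0 < σ → σ ≤ σ₁ → ∀ (α : ℝ), 0 < α → α < 1 → ∀ (β : ℝ), 0 ≤ β → β < 1 →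
    ∃ B₂ M₂ : ℝ, 0 ≤ B₂ ∧ 0 < M₂ ∧
    ∀ (m K : ℕ) {Mh k R : ℕ} {P' : Fin (d + 1) → ℕ}
      (hN : ∀ μ, N0 ℓ Mh k P' μ = (PV d ℓ m K hd hL).sitesPerDir 0) (D : TDomains d ℓ Mh k P' R) (hk : k ≤ m + K) (_ : 1 ≤ k)
      {a : ℕ} (_ : Mh = (ℓ + 1) ^ a) (_ : 8 ≤ Mh) (_ : 2 * (ℓ + 1) ^ 2 ≤ R) (_ : ∀ μ, 5 * (ℓ + 1) ≤ P' μ) (_ : 4 ≤ ℓ)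
      (_ : M₂ ≤ ((ℓ : ℝ) + 1) * Mh)
      {cf : ℝ} (hcf : cf ≠ 0) {w : BondIdx (domT hN D hk) → ℝ} (hw : ∀ i, 0 < w i) (_ : GlobalBand b₀ b₁ cf w),
      ∀ (A' : BondSpace (PV d ℓ m K hd hL)) (α₀ α₁ : ℝ), 0 ≤ α₀ → 0 ≤ α₁ →
        (∀ b, |dcsE cf (dcE cf A') b| ≤ 2 * α₀ * (((geomT D).len (blkV1 hN D b) * |cf|⁻¹) ^ 3)⁻¹) →
        (∀ i, |QE (domT hN D hk) A' i| ≤ 2 * ((d : ℝ) + 1) * ((ℓ : ℝ) + 1) * α₁ * (((ℓ : ℝ) + 1) ^ (i.1.1 : ℕ) * |cf|⁻¹)⁻¹) →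
      ∀ n : ScalarSpace (PV d ℓ m K hd hL), n ∈ LinearMap.ker (QpE (domT hN D hk)) →
        RE (domT hN D hk) cf (dsE cf (A' - dE cf n)) = 0 →
      ∀ (ν : Fin (d + 1)) (x x' : PBond (PV d ℓ m K hd hL) 0), AdmV1 hN D x x' →
        tparV1 hN D x x' ^ (-β) *
            |DV (P := PV d ℓ m K hd hL) ν cf (WithLp.ofLp (A' - dE cf n)) x -
              DV (P := PV d ℓ m K hd hL) ν cf (WithLp.ofLp (A' - dE cf n)) x'| ≤
          B₂ * (α₀ + α₁) * (((geomT D).len (blkV1 hN D x) * |cf|⁻¹) ^ 2)⁻¹ := by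
  obtain ⟨σ₁, hσ₁, h⟩ := thm4_holder_member_V1_free d ℓ hd hL hb₀ hb₁
  refine ⟨σ₁, hσ₁, fun σ hσ hσ1 α hα0 hα1 β hβ0 hβ1 => ?_⟩
  obtain ⟨B₂, M₂, hB₂, hM₂, h2⟩ := h σ hσ hσ1 α hα0 hα1 β hβ0 hβ1
  refine ⟨B₂, M₂, hB₂, hM₂, ?_⟩
  intro m K Mh k R P' hN D hk hk1 a hMha hM8 hR2 hP hℓ hM cf hcf w hw hwb A' α₀ α₁ hα₀ hα₁ hJ hB n hn hLan ν x x' hadm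
  obtain ⟨hdir, hs1, hs2⟩ := hadm
  have key := h2 m K hN D hk hk1 hMha hM8 hR2 hP hℓ hM hcf hw hwb A' α₀ α₁ hα₀ hα₁ hJ hB n hn hLan ν x x' hdir hs1 hs2
  -- `key : |Δ| ≤ B₂ · t^β · (α₀ + α₁) · W` with `t = tparV1 hN D x x′` literally
  change |_| ≤ B₂ * tparV1 hN D x x' ^ β * (α₀ + α₁) * _ at key
  set t : ℝ := tparV1 hN D x x' with ht
  set W : ℝ := (((geomT D).len (blkV1 hN D x) * |cf|⁻¹) ^ 2)⁻¹ with hW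
  have hW0 : 0 ≤ W := inv_nonneg.2 (pow_nonneg (mul_nonneg (lenT_pos D _).le (inv_nonneg.2 (abs_nonneg cf))) 2)
  have hS : 0 ≤ α₀ + α₁ := add_nonneg hα₀ hα₁
  have ht0 : 0 ≤ t := tparV1_nonneg hN D x x'
  rcases ht0.eq_or_lt with heq | hpos
  · -- `t = 0`: either `β = 0` (then `t^{−β} = t^{β} = 1`) or `0^{−β} = 0`
    by_cases hβ : β = 0
    · subst hβ
      rw [neg_zero, Real.rpow_zero, one_mul]
      simpa only [Real.rpow_zero, mul_one] using key
    · rw [← heq, Real.zero_rpow (neg_ne_zero.2 hβ), zero_mul]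
      exact mul_nonneg (mul_nonneg hB₂ hS) hW0
  · have htβ : 0 < t ^ β := Real.rpow_pos_of_pos hpos β
    calc t ^ (-β) * |DV (P := PV d ℓ m K hd hL) ν cf (WithLp.ofLp (A' - dE cf n)) x -
            DV (P := PV d ℓ m K hd hL) ν cf (WithLp.ofLp (A' - dE cf n)) x'|
        ≤ t ^ (-β) * (B₂ * t ^ β * (α₀ + α₁) * W) := mul_le_mul_of_nonneg_left key (Real.rpow_nonneg hpos.le _)
      _ = B₂ * (α₀ + α₁) * W * (t ^ (-β) * t ^ β) := by ring
      _ = B₂ * (α₀ + α₁) * W := by rw [Real.rpow_neg hpos.le, inv_mul_cancel₀ htβ.ne', mul_one]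

end Quotient1109

end

end Literature.MathematicalPhysics.QuantumFieldTheory.Balaban1983to89.B8Prop3MultiLevelTorusHolder
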